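import Literature.NumberTheory.Sieve.FriedlanderIwaniecPrimesJacobiTwistedMediumModuli
import Literature.NumberTheory.Sieve.FriedlanderIwaniecPrimesJacobiTwistedProp111
import Mathlib.Analysis.Complex.ExponentialBounds
import HarnessLib

/-!
# Friedlander–Iwaniec, *The polynomial `X² + Y⁴` captures its primes*, §13: Proposition 13.1 from Proposition 12.1 (the choice of `P`)

[FI, §13, p. 53 of arXiv:math/9811185]:

> "PROPOSITION 13.1. Let `D, R, S ≥ 1`. For any complex numbers `α_{rs}` with `(r, 2s) = 1`
> supported in the box (11.6) we have
> (13.5) `V(D) ≪ {D(R+S)^{1/4}(RS)^{1/4} + D^{-1/2}(R+S)^{1/8}(RS)^{9/8}}(RS)^ε ‖α‖²`.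
> *Proof.* We can assume that (13.6) `(R+S)^{1/4}(RS)^{1/4} ≤ D ≤ (R+S)^{-1/4}(RS)^{3/4}` or else
> the bound (13.5) is trivial. Applying (12.3) to `V(D⁺)` in (13.4) we obtain
> `V(D) ≪ {D^{1/3}P^{5/3}(RS)^{2/3} + (DP)⁻¹(RS)^{3/2} + P(R+S)^{1/4}(RS)^{3/4} + DP³ + P⁻²RS}(PRS)^ε ‖α‖²`.
> We choose `P = D^{-1/2}(R+S)^{-1/8}(RS)^{3/8}` getting (13.5)."

This file PROVES that deduction — Proposition 13.1 with Proposition 12.1 ((12.3)–(12.4), not yet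
in the tree) as an explicit hypothesis `h12` quantified over ALL levels, the right-hand side
carrying the weight `τ(r)` of (12.3) (the printed `‖α‖²` of (13.5) absorbs `τ(r) ≤ r^ε`; the
consumer `jtV_le_of_three_ranges` (Proposition 14.1) takes the `τ`-weighted form):

* `jtV_le_of_level_bounds'` — the all-`D` form of the tree's `jtV_le_of_level_bounds` (§13
  display before "We choose `P`"), from the multiplicity form (13.4)
  `jtV_le_enlarged_principle'` of the principle of enlarging moduli: no hypothesis `2D < P²`, at
  the price of the factor `1 + ⌊log_P(8D)/2⌋` (the printed `log DP`);
* `jtV_prop131_of_prop121` — **Proposition 13.1 from Proposition 12.1**: outside (13.6) the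
  bound follows from Proposition 11.1 (tree: `exists_jtV_le`) for small `D` and from (12.3) at
  level `D` for large `D` (this also covers the finitely many `P < P₀` excluded by the prime number
  theorem input of (13.4)); inside (13.6) we take `P = ⌈D^{-1/2}(R+S)^{-1/8}(RS)^{3/8}⌉` and
  verify term by term that the display is `≪ (13.5)`, the logarithms `(log 2RS)⁴`, `log 2P`,
  `log DP` being absorbed by `(RS)^{ε/2}`.

No definitions, no named facts; Proposition 12.1 enters only as the hypothesis `h12`.
-/

open Finset Real
open scoped Nat ArithmeticFunction.sigma

namespace Literature.NumberTheory.Sieve.FriedlanderIwaniecPrimes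

/-! ### (13.4) with level bounds, all `D` -/

/-- `V_{(D₁, D₃]} = V_{(D₁, D₂]} + V_{(D₂, D₃]}` for `D₁ ≤ D₂ ≤ D₃`. [folklore] -/
private theorem jtV_split' {D₁ D₂ D₃ : ℕ} (h₁ : D₁ ≤ D₂) (h₂ : D₂ ≤ D₃) (R S : ℕ) (α : ℕ → ℕ → ℂ) :
    jtV D₁ D₃ R S α = jtV D₁ D₂ R S α + jtV D₂ D₃ R S α := by
  rw [jtV_def, jtV_def, jtV_def, Finset.sum_Ioc_consecutive _ h₁ h₂]

/-- `V ≥ 0`. [folklore] -/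
private theorem jtV_nonneg₃ (D₁ D₂ R S : ℕ) (α : ℕ → ℕ → ℂ) : 0 ≤ jtV D₁ D₂ R S α := by
  rw [jtV_def]; positivity

/-- **(13.4) with Proposition 12.1 inserted, for all `D`** (the display before "We choose `P`",
multiplicity form): for every `ε > 0` there are `C ≥ 1` and `P₀ ≥ 2` such that for all `P ≥ P₀`,
all `D, R, S`, coefficients `α_{rs}` supported on `(r, s) = 1`, and any numbers `L₀, L₁, L₂` with
`V(2^jDP²) ≤ L_j Σ τ(r)|α_{rs}|²` (`j = 0, 1, 2`):
`V(D) ≤ {16 (1 + ⌊log_P(8D)/2⌋) P log(2P)(L₀ + L₁ + L₂) + 8 P⁻¹ log(2P)(D + (R/P + 1) S · C(4RS)^ε)} Σ τ(r)|α_{rs}|²`.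
[cite: FriedlanderIwaniecAnnals1998, Proposition 13.1 (proof, display before "We choose P")] -/
theorem jtV_le_of_level_bounds' {ε : ℝ} (hε : 0 < ε) :
    ∃ C : ℝ, 1 ≤ C ∧ ∃ P₀ : ℕ, 2 ≤ P₀ ∧ ∀ (P D R S : ℕ), P₀ ≤ P → ∀ α : ℕ → ℕ → ℂ,
      (∀ r s, α r s ≠ 0 → r.Coprime s) → ∀ L₀ L₁ L₂ : ℝ,
      jtV (D * P ^ 2) (2 * (D * P ^ 2)) R S α ≤
        L₀ * ∑ r ∈ Ioc R (2 * R), ∑ s ∈ Ioc S (2 * S), (σ 0 r : ℝ) * ‖α r s‖ ^ 2 →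
      jtV (2 * (D * P ^ 2)) (4 * (D * P ^ 2)) R S α ≤
        L₁ * ∑ r ∈ Ioc R (2 * R), ∑ s ∈ Ioc S (2 * S), (σ 0 r : ℝ) * ‖α r s‖ ^ 2 →
      jtV (4 * (D * P ^ 2)) (8 * (D * P ^ 2)) R S α ≤
        L₂ * ∑ r ∈ Ioc R (2 * R), ∑ s ∈ Ioc S (2 * S), (σ 0 r : ℝ) * ‖α r s‖ ^ 2 →
      jtV D (2 * D) R S α ≤
        (16 * ((1 + Nat.log P (8 * D) / 2 : ℕ) : ℝ) * P * Real.log (2 * P) * (L₀ + L₁ + L₂) +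
          8 * (Real.log (2 * P) / P) * (D + ((R : ℝ) / P + 1) * S * (C * ((4 : ℝ) * R * S) ^ ε))) *
        ∑ r ∈ Ioc R (2 * R), ∑ s ∈ Ioc S (2 * S), (σ 0 r : ℝ) * ‖α r s‖ ^ 2 := by
  obtain ⟨C, hC1, hC⟩ := jtV_le_trivial_of_dvd_rpow hε
  obtain ⟨P₀, hP₀⟩ := jtV_le_enlarged_principle'
  refine ⟨C, hC1, max P₀ 2, le_max_right _ _, fun P D R S hP α hαc L₀ L₁ L₂ h0 h1 h2 => ?_⟩
  have hP2 : 2 ≤ P := le_trans (le_max_right _ _) hP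
  have hP1 : 1 ≤ P := by omega
  have hPpos : (0 : ℝ) < P := by exact_mod_cast hP1
  set Nτ : ℝ := ∑ r ∈ Ioc R (2 * R), ∑ s ∈ Ioc S (2 * S), (σ 0 r : ℝ) * ‖α r s‖ ^ 2 with hNτ
  have hNτ0 : 0 ≤ Nτ := by rw [hNτ]; positivity
  have hlog : 0 ≤ Real.log (2 * P) := Real.log_nonneg (by
    have : (1 : ℝ) ≤ P := by exact_mod_cast hP1
    linarith)
  have hmain := hP₀ P D R S (le_trans (le_max_left _ _) hP) α
  set M : ℝ := ((1 + Nat.log P (8 * D) / 2 : ℕ) : ℝ) with hM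
  have hM0 : 0 ≤ M := Nat.cast_nonneg _
  -- the enlarged levels
  have hsplit : jtV (D * P ^ 2) (8 * (D * P ^ 2)) R S α =
      jtV (D * P ^ 2) (2 * (D * P ^ 2)) R S α + jtV (2 * (D * P ^ 2)) (4 * (D * P ^ 2)) R S α +
        jtV (4 * (D * P ^ 2)) (8 * (D * P ^ 2)) R S α := by
    rw [jtV_split' (D₂ := 2 * (D * P ^ 2)) (by omega) (by omega),
      jtV_split' (D₁ := 2 * (D * P ^ 2)) (D₂ := 4 * (D * P ^ 2)) (by omega) (by omega), add_assoc]
  have hlev : jtV (D * P ^ 2) (8 * (D * P ^ 2)) R S α ≤ (L₀ + L₁ + L₂) * Nτ := by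
    rw [hsplit]; linarith
  -- the trivial estimates, summed over `p`
  set Pr := (Ioc P (2 * P)).filter Nat.Prime with hPr
  have hPr' : ∀ p ∈ Pr, p.Prime ∧ P < p ∧ p ≤ 2 * P := by
    intro p hp
    rw [hPr, Finset.mem_filter, Finset.mem_Ioc] at hp
    exact ⟨hp.2, hp.1.1, hp.1.2⟩
  set K : ℝ := (D : ℝ) + ((R : ℝ) / P + 1) * S * (C * ((4 : ℝ) * R * S) ^ ε) with hK
  have hK0 : 0 ≤ K := by rw [hK]; positivity
  have htriv : ∀ p ∈ Pr, Real.log p / p * jtV D (2 * D) R S (fun r s => if p ∣ r then α r s else 0) ≤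
      Real.log (2 * P) / P * (K * ∑ r ∈ Ioc R (2 * R), ∑ s ∈ Ioc S (2 * S),
        ‖(fun r s => if p ∣ r then α r s else 0) r s‖ ^ 2) := by
    intro p hp
    obtain ⟨hpp, hP₁, hP₂⟩ := hPr' p hp
    have hp0 : (0 : ℝ) < p := by exact_mod_cast hpp.pos
    have hw : Real.log p / p ≤ Real.log (2 * P) / P := by
      have hlogp : Real.log p ≤ Real.log (2 * P) := Real.log_le_log hp0 (by exact_mod_cast hP₂)
      have hlogp0 : 0 ≤ Real.log p := Real.log_nonneg (by exact_mod_cast hpp.one_lt.le)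
      calc Real.log p / p ≤ Real.log p / P :=
            div_le_div_of_nonneg_left hlogp0 hPpos (by exact_mod_cast hP₁.le)
        _ ≤ Real.log (2 * P) / P := div_le_div_of_nonneg_right hlogp hPpos.le
    have hw0 : 0 ≤ Real.log p / p :=
      div_nonneg (Real.log_nonneg (by exact_mod_cast hpp.one_lt.le)) hp0.le
    have ht := hC D R S hpp (fun r s => if p ∣ r then α r s else 0)
      (fun r s h => by
        by_contra hpr
        exact h (by simp [hpr]))
      (fun r s h => by
        by_cases hpr : p ∣ r
        · have h' : α r s ≠ 0 := by simpa [hpr] using h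
          exact hαc r s h'
        · exact absurd (by simp [hpr]) h)
    have hKp : (D : ℝ) + ((R : ℝ) / p + 1) * S * (C * ((4 : ℝ) * R * S) ^ ε) ≤ K := by
      rw [hK]
      have : (R : ℝ) / p ≤ (R : ℝ) / P :=
        div_le_div_of_nonneg_left (Nat.cast_nonneg _) hPpos (by exact_mod_cast hP₁.le)
      have hC0 : 0 ≤ C * ((4 : ℝ) * R * S) ^ ε := by positivity
      nlinarith [this, hC0, Nat.cast_nonneg (α := ℝ) S, mul_nonneg (Nat.cast_nonneg (α := ℝ) S) hC0]
    have hN0 : 0 ≤ ∑ r ∈ Ioc R (2 * R), ∑ s ∈ Ioc S (2 * S),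
        ‖(fun r s => if p ∣ r then α r s else 0) r s‖ ^ 2 := by positivity
    calc Real.log p / p * jtV D (2 * D) R S (fun r s => if p ∣ r then α r s else 0)
        ≤ Real.log p / p * (K * ∑ r ∈ Ioc R (2 * R), ∑ s ∈ Ioc S (2 * S),
            ‖(fun r s => if p ∣ r then α r s else 0) r s‖ ^ 2) :=
          mul_le_mul_of_nonneg_left (ht.trans (mul_le_mul_of_nonneg_right hKp hN0)) hw0
      _ ≤ Real.log (2 * P) / P * (K * ∑ r ∈ Ioc R (2 * R), ∑ s ∈ Ioc S (2 * S),
            ‖(fun r s => if p ∣ r then α r s else 0) r s‖ ^ 2) :=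
          mul_le_mul_of_nonneg_right hw (mul_nonneg hK0 hN0)
  have htrivsum : ∑ p ∈ Pr, Real.log p / p *
      jtV D (2 * D) R S (fun r s => if p ∣ r then α r s else 0) ≤ Real.log (2 * P) / P * (K * Nτ) := by
    refine (Finset.sum_le_sum htriv).trans ?_
    rw [← Finset.mul_sum, ← Finset.mul_sum]
    refine mul_le_mul_of_nonneg_left (mul_le_mul_of_nonneg_left ?_ hK0) (by positivity)
    exact sum_primes_normSq_dvd_le_tau Pr R S α
  -- assemble
  have h16 : 0 ≤ 16 * M * (P : ℝ) * Real.log (2 * P) := by positivity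
  calc jtV D (2 * D) R S α
      ≤ 16 * M * P * Real.log (2 * P) * jtV (D * P ^ 2) (8 * (D * P ^ 2)) R S α +
          8 * ∑ p ∈ Pr, Real.log p / p * jtV D (2 * D) R S (fun r s => if p ∣ r then α r s else 0) := by
        rw [hM]; exact hmain
    _ ≤ 16 * M * P * Real.log (2 * P) * ((L₀ + L₁ + L₂) * Nτ) + 8 * (Real.log (2 * P) / P * (K * Nτ)) := by
        have a := mul_le_mul_of_nonneg_left hlev h16
        linarith
    _ = (16 * M * P * Real.log (2 * P) * (L₀ + L₁ + L₂) + 8 * (Real.log (2 * P) / P) * K) * Nτ := by ring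

/-! ### The exponent bookkeeping for the choice `P ≍ D^{-1/2}(R+S)^{-1/8}(RS)^{3/8}`

Throughout: `x = R`, `y = S`, `d = D` (reals `≥ 1`), `T₁ = d(x+y)^{1/4}(xy)^{1/4}`,
`T₂ = d^{-1/2}(x+y)^{1/8}(xy)^{9/8}` (the two terms of (13.5)) and
`t = d^{-1/2}(x+y)^{-1/8}(xy)^{3/8}` (the printed `P`). -/

section RealIneq131

variable {d x y : ℝ}

/-- `x + y ≤ 2xy` for `x, y ≥ 1`. [folklore] -/
private theorem add_le_two_mul_mul (hx : 1 ≤ x) (hy : 1 ≤ y) : x + y ≤ 2 * (x * y) := by nlinarith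

/-- `x y^{3/4} + y x^{3/4} ≤ 2 (x+y)^{1/4}(xy)^{3/4}` for `x, y ≥ 1`. [folklore] -/
private theorem cross_le_two_mul (hx : 1 ≤ x) (hy : 1 ≤ y) :
    x * y ^ (3 / 4 : ℝ) + y * x ^ (3 / 4 : ℝ) ≤ 2 * ((x + y) ^ (1 / 4 : ℝ) * (x * y) ^ (3 / 4 : ℝ)) := by
  have hx0 : 0 < x := by linarith
  have hy0 : 0 < y := by linarith
  have ex : x = x ^ (1 / 4 : ℝ) * x ^ (3 / 4 : ℝ) := by rw [← Real.rpow_add hx0]; norm_num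
  have ey : y = y ^ (1 / 4 : ℝ) * y ^ (3 / 4 : ℝ) := by rw [← Real.rpow_add hy0]; norm_num
  rw [Real.mul_rpow hx0.le hy0.le]
  have h1 : x * y ^ (3 / 4 : ℝ) ≤ (x + y) ^ (1 / 4 : ℝ) * (x ^ (3 / 4 : ℝ) * y ^ (3 / 4 : ℝ)) := by
    calc x * y ^ (3 / 4 : ℝ) = x ^ (1 / 4 : ℝ) * (x ^ (3 / 4 : ℝ) * y ^ (3 / 4 : ℝ)) := by
          conv_lhs => rw [ex]
          ring
      _ ≤ (x + y) ^ (1 / 4 : ℝ) * (x ^ (3 / 4 : ℝ) * y ^ (3 / 4 : ℝ)) :=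
          mul_le_mul_of_nonneg_right (Real.rpow_le_rpow hx0.le (by linarith) (by norm_num))
            (by positivity)
  have h2 : y * x ^ (3 / 4 : ℝ) ≤ (x + y) ^ (1 / 4 : ℝ) * (x ^ (3 / 4 : ℝ) * y ^ (3 / 4 : ℝ)) := by
    calc y * x ^ (3 / 4 : ℝ) = y ^ (1 / 4 : ℝ) * (x ^ (3 / 4 : ℝ) * y ^ (3 / 4 : ℝ)) := by
          conv_lhs => rw [ey]
          ring
      _ ≤ (x + y) ^ (1 / 4 : ℝ) * (x ^ (3 / 4 : ℝ) * y ^ (3 / 4 : ℝ)) :=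
          mul_le_mul_of_nonneg_right (Real.rpow_le_rpow hy0.le (by linarith) (by norm_num))
            (by positivity)
  linarith

/-- `(x+y)^{1/4}(xy)^{3/4} ≤ 2 xy` for `x, y ≥ 1`. [folklore] -/
private theorem quarter_mul_le_two_mul (hx : 1 ≤ x) (hy : 1 ≤ y) :
    (x + y) ^ (1 / 4 : ℝ) * (x * y) ^ (3 / 4 : ℝ) ≤ 2 * (x * y) := by
  have hp0 : 0 < x * y := mul_pos (by linarith) (by linarith)
  have hs := add_le_two_mul_mul hx hy
  calc (x + y) ^ (1 / 4 : ℝ) * (x * y) ^ (3 / 4 : ℝ)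
      ≤ (2 * (x * y)) ^ (1 / 4 : ℝ) * (x * y) ^ (3 / 4 : ℝ) := by gcongr
    _ = (2 : ℝ) ^ (1 / 4 : ℝ) * ((x * y) ^ (1 / 4 : ℝ) * (x * y) ^ (3 / 4 : ℝ)) := by
        rw [Real.mul_rpow (by norm_num) hp0.le]; ring
    _ = (2 : ℝ) ^ (1 / 4 : ℝ) * (x * y) := by rw [← Real.rpow_add hp0]; norm_num
    _ ≤ 2 * (x * y) := by
        gcongr
        calc (2 : ℝ) ^ (1 / 4 : ℝ) ≤ (2 : ℝ) ^ (1 : ℝ) :=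
              Real.rpow_le_rpow_of_exponent_le (by norm_num) (by norm_num)
          _ = 2 := Real.rpow_one 2

/-- The square of the printed `P`: `t² = d⁻¹ (x+y)^{-1/4}(xy)^{3/4}`. [folklore] -/
private theorem t_sq (hd : 0 < d) (hx : 1 ≤ x) (hy : 1 ≤ y) :
    (d ^ (-(1 / 2 : ℝ)) * (x + y) ^ (-(1 / 8 : ℝ)) * (x * y) ^ (3 / 8 : ℝ)) ^ 2 =
      d⁻¹ * ((x + y) ^ (-(1 / 4 : ℝ)) * (x * y) ^ (3 / 4 : ℝ)) := by
  have hs0 : 0 < x + y := by linarith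
  have hp0 : 0 < x * y := mul_pos (by linarith) (by linarith)
  rw [mul_pow, mul_pow, ← Real.rpow_natCast, ← Real.rpow_natCast, ← Real.rpow_natCast,
    ← Real.rpow_mul hd.le, ← Real.rpow_mul hs0.le, ← Real.rpow_mul hp0.le]
  norm_num
  rw [Real.rpow_neg_one, mul_assoc]

/-- If `t ≥ 1` then `d ≤ (x+y)^{-1/4}(xy)^{3/4}` (the upper half of (13.6)). [folklore] -/
private theorem le_upper_of_one_le_t (hd : 0 < d) (hx : 1 ≤ x) (hy : 1 ≤ y)
    (ht : 1 ≤ d ^ (-(1 / 2 : ℝ)) * (x + y) ^ (-(1 / 8 : ℝ)) * (x * y) ^ (3 / 8 : ℝ)) :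
    d ≤ (x + y) ^ (-(1 / 4 : ℝ)) * (x * y) ^ (3 / 4 : ℝ) := by
  have h1 : (1 : ℝ) ≤ (d ^ (-(1 / 2 : ℝ)) * (x + y) ^ (-(1 / 8 : ℝ)) * (x * y) ^ (3 / 8 : ℝ)) ^ 2 := by
    nlinarith
  rw [t_sq hd hx hy] at h1
  have hW : 0 ≤ (x + y) ^ (-(1 / 4 : ℝ)) * (x * y) ^ (3 / 4 : ℝ) := by positivity
  rwa [le_inv_mul_iff₀ hd, mul_one] at h1

/-- Term (a): `d t³ ≤ T₂`. [folklore] -/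
private theorem term_a (hd : 0 < d) (hx : 1 ≤ x) (hy : 1 ≤ y) :
    d * (d ^ (-(1 / 2 : ℝ)) * (x + y) ^ (-(1 / 8 : ℝ)) * (x * y) ^ (3 / 8 : ℝ)) ^ 3 ≤
      d ^ (-(1 / 2 : ℝ)) * (x + y) ^ (1 / 8 : ℝ) * (x * y) ^ (9 / 8 : ℝ) := by
  have hs0 : 0 < x + y := by linarith
  have hs1 : 1 ≤ x + y := by linarith
  have hp0 : 0 < x * y := mul_pos (by linarith) (by linarith)
  have e : d * (d ^ (-(1 / 2 : ℝ)) * (x + y) ^ (-(1 / 8 : ℝ)) * (x * y) ^ (3 / 8 : ℝ)) ^ 3 =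
      d ^ (-(1 / 2 : ℝ)) * (x + y) ^ (-(3 / 8 : ℝ)) * (x * y) ^ (9 / 8 : ℝ) := by
    rw [mul_pow, mul_pow, ← Real.rpow_natCast (d ^ _), ← Real.rpow_natCast ((x + y) ^ _),
      ← Real.rpow_natCast ((x * y) ^ _), ← Real.rpow_mul hd.le, ← Real.rpow_mul hs0.le,
      ← Real.rpow_mul hp0.le]
    have : d * d ^ (-(1 / 2 : ℝ) * (3 : ℕ)) = d ^ (-(1 / 2 : ℝ)) := by
      have h := Real.rpow_add hd 1 (-(1 / 2 : ℝ) * (3 : ℕ))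
      rw [Real.rpow_one] at h
      rw [← h]; norm_num
    calc d * (d ^ (-(1 / 2 : ℝ) * (3 : ℕ)) * (x + y) ^ (-(1 / 8 : ℝ) * (3 : ℕ)) * (x * y) ^ ((3 / 8 : ℝ) * (3 : ℕ)))
        = (d * d ^ (-(1 / 2 : ℝ) * (3 : ℕ))) * (x + y) ^ (-(1 / 8 : ℝ) * (3 : ℕ)) * (x * y) ^ ((3 / 8 : ℝ) * (3 : ℕ)) := by
          ring
      _ = _ := by rw [this]; norm_num
  rw [e]
  exact mul_le_mul_of_nonneg_right (mul_le_mul_of_nonneg_left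
    (Real.rpow_le_rpow_of_exponent_le hs1 (by norm_num)) (by positivity)) (by positivity)

/-- Term (b): `d^{1/3} t^{5/3} (xy)^{2/3} ≤ T₂` (uses `xy ≤ (x+y)²`). [folklore] -/
private theorem term_b (hd : 0 < d) (hx : 1 ≤ x) (hy : 1 ≤ y) :
    d ^ (1 / 3 : ℝ) * (d ^ (-(1 / 2 : ℝ)) * (x + y) ^ (-(1 / 8 : ℝ)) * (x * y) ^ (3 / 8 : ℝ)) ^ (5 / 3 : ℝ) *
        (x * y) ^ (2 / 3 : ℝ) ≤
      d ^ (-(1 / 2 : ℝ)) * (x + y) ^ (1 / 8 : ℝ) * (x * y) ^ (9 / 8 : ℝ) := by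
  have hs0 : 0 < x + y := by linarith
  have hp0 : 0 < x * y := mul_pos (by linarith) (by linarith)
  have hps : x * y ≤ (x + y) ^ 2 := by nlinarith
  -- expand `t^{5/3}`
  have e : d ^ (1 / 3 : ℝ) * (d ^ (-(1 / 2 : ℝ)) * (x + y) ^ (-(1 / 8 : ℝ)) * (x * y) ^ (3 / 8 : ℝ)) ^ (5 / 3 : ℝ) *
        (x * y) ^ (2 / 3 : ℝ) =
      d ^ (-(1 / 2 : ℝ)) * (x + y) ^ (-(5 / 24 : ℝ)) * (x * y) ^ (31 / 24 : ℝ) := by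
    rw [Real.mul_rpow (by positivity) (by positivity), Real.mul_rpow (by positivity) (by positivity),
      ← Real.rpow_mul hd.le, ← Real.rpow_mul hs0.le, ← Real.rpow_mul hp0.le]
    have h1 : d ^ (1 / 3 : ℝ) * d ^ (-(1 / 2 : ℝ) * (5 / 3 : ℝ)) = d ^ (-(1 / 2 : ℝ)) := by
      rw [← Real.rpow_add hd]; norm_num
    have h2 : (x * y) ^ ((3 / 8 : ℝ) * (5 / 3 : ℝ)) * (x * y) ^ (2 / 3 : ℝ) = (x * y) ^ (31 / 24 : ℝ) := by
      rw [← Real.rpow_add hp0]; norm_num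
    calc d ^ (1 / 3 : ℝ) * (d ^ (-(1 / 2 : ℝ) * (5 / 3 : ℝ)) * (x + y) ^ (-(1 / 8 : ℝ) * (5 / 3 : ℝ)) *
          (x * y) ^ ((3 / 8 : ℝ) * (5 / 3 : ℝ))) * (x * y) ^ (2 / 3 : ℝ)
        = (d ^ (1 / 3 : ℝ) * d ^ (-(1 / 2 : ℝ) * (5 / 3 : ℝ))) * (x + y) ^ (-(1 / 8 : ℝ) * (5 / 3 : ℝ)) *
            ((x * y) ^ ((3 / 8 : ℝ) * (5 / 3 : ℝ)) * (x * y) ^ (2 / 3 : ℝ)) := by ring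
      _ = _ := by rw [h1, h2]; norm_num
  rw [e]
  -- `(xy)^{31/24} (x+y)^{-5/24} ≤ (xy)^{27/24} (x+y)^{3/24}` iff `(xy)^{1/6} ≤ (x+y)^{1/3}`
  have key : (x * y) ^ (1 / 6 : ℝ) ≤ (x + y) ^ (1 / 3 : ℝ) := by
    calc (x * y) ^ (1 / 6 : ℝ) ≤ ((x + y) ^ 2) ^ (1 / 6 : ℝ) :=
          Real.rpow_le_rpow hp0.le hps (by norm_num)
      _ = (x + y) ^ (1 / 3 : ℝ) := by
          rw [← Real.rpow_natCast, ← Real.rpow_mul hs0.le]; norm_num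
  have e1 : (x + y) ^ (-(5 / 24 : ℝ)) * (x * y) ^ (31 / 24 : ℝ) =
      ((x + y) ^ (-(5 / 24 : ℝ)) * (x * y) ^ (9 / 8 : ℝ)) * (x * y) ^ (1 / 6 : ℝ) := by
    rw [mul_assoc, ← Real.rpow_add hp0]; norm_num
  have e2 : (x + y) ^ (1 / 8 : ℝ) * (x * y) ^ (9 / 8 : ℝ) =
      ((x + y) ^ (-(5 / 24 : ℝ)) * (x * y) ^ (9 / 8 : ℝ)) * (x + y) ^ (1 / 3 : ℝ) := by
    have : (x + y) ^ (1 / 8 : ℝ) = (x + y) ^ (-(5 / 24 : ℝ)) * (x + y) ^ (1 / 3 : ℝ) := by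
      rw [← Real.rpow_add hs0]; norm_num
    rw [this]; ring
  rw [mul_assoc, mul_assoc, e1, e2]
  exact mul_le_mul_of_nonneg_left (mul_le_mul_of_nonneg_left key (by positivity)) (by positivity)

/-- Term (c): `d⁻¹ t⁻¹ (xy)^{3/2} = T₂`. [folklore] -/
private theorem term_c (hd : 0 < d) (hx : 1 ≤ x) (hy : 1 ≤ y) :
    d⁻¹ * (d ^ (-(1 / 2 : ℝ)) * (x + y) ^ (-(1 / 8 : ℝ)) * (x * y) ^ (3 / 8 : ℝ))⁻¹ * (x * y) ^ (3 / 2 : ℝ) =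
      d ^ (-(1 / 2 : ℝ)) * (x + y) ^ (1 / 8 : ℝ) * (x * y) ^ (9 / 8 : ℝ) := by
  have hs0 : 0 < x + y := by linarith
  have hp0 : 0 < x * y := mul_pos (by linarith) (by linarith)
  rw [mul_inv, mul_inv, ← Real.rpow_neg hd.le, ← Real.rpow_neg hs0.le, ← Real.rpow_neg hp0.le, neg_neg,
    neg_neg, ← Real.rpow_neg_one]
  have h1 : d ^ (-1 : ℝ) * d ^ (1 / 2 : ℝ) = d ^ (-(1 / 2 : ℝ)) := by rw [← Real.rpow_add hd]; norm_num
  have h2 : (x * y) ^ (-(3 / 8 : ℝ)) * (x * y) ^ (3 / 2 : ℝ) = (x * y) ^ (9 / 8 : ℝ) := by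
    rw [← Real.rpow_add hp0]; norm_num
  calc d ^ (-1 : ℝ) * (d ^ (1 / 2 : ℝ) * (x + y) ^ (1 / 8 : ℝ) * (x * y) ^ (-(3 / 8 : ℝ))) * (x * y) ^ (3 / 2 : ℝ)
      = (d ^ (-1 : ℝ) * d ^ (1 / 2 : ℝ)) * (x + y) ^ (1 / 8 : ℝ) * ((x * y) ^ (-(3 / 8 : ℝ)) * (x * y) ^ (3 / 2 : ℝ)) := by
        ring
    _ = _ := by rw [h1, h2]

/-- Term (d): `t (x+y)^{1/4}(xy)^{3/4} = T₂`. [folklore] -/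
private theorem term_d (hx : 1 ≤ x) (hy : 1 ≤ y) :
    (d ^ (-(1 / 2 : ℝ)) * (x + y) ^ (-(1 / 8 : ℝ)) * (x * y) ^ (3 / 8 : ℝ)) *
        ((x + y) ^ (1 / 4 : ℝ) * (x * y) ^ (3 / 4 : ℝ)) =
      d ^ (-(1 / 2 : ℝ)) * (x + y) ^ (1 / 8 : ℝ) * (x * y) ^ (9 / 8 : ℝ) := by
  have hs0 : 0 < x + y := by linarith
  have hp0 : 0 < x * y := mul_pos (by linarith) (by linarith)
  have h1 : (x + y) ^ (-(1 / 8 : ℝ)) * (x + y) ^ (1 / 4 : ℝ) = (x + y) ^ (1 / 8 : ℝ) := by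
    rw [← Real.rpow_add hs0]; norm_num
  have h2 : (x * y) ^ (3 / 8 : ℝ) * (x * y) ^ (3 / 4 : ℝ) = (x * y) ^ (9 / 8 : ℝ) := by
    rw [← Real.rpow_add hp0]; norm_num
  calc (d ^ (-(1 / 2 : ℝ)) * (x + y) ^ (-(1 / 8 : ℝ)) * (x * y) ^ (3 / 8 : ℝ)) * ((x + y) ^ (1 / 4 : ℝ) * (x * y) ^ (3 / 4 : ℝ))
      = d ^ (-(1 / 2 : ℝ)) * ((x + y) ^ (-(1 / 8 : ℝ)) * (x + y) ^ (1 / 4 : ℝ)) *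
          ((x * y) ^ (3 / 8 : ℝ) * (x * y) ^ (3 / 4 : ℝ)) := by ring
    _ = _ := by rw [h1, h2]

/-- Term (e): `d / t ≤ T₁` when `t ≥ 1`. [folklore] -/
private theorem term_e (hd : 0 < d) (hx : 1 ≤ x) (hy : 1 ≤ y)
    (ht : 1 ≤ d ^ (-(1 / 2 : ℝ)) * (x + y) ^ (-(1 / 8 : ℝ)) * (x * y) ^ (3 / 8 : ℝ)) :
    d / (d ^ (-(1 / 2 : ℝ)) * (x + y) ^ (-(1 / 8 : ℝ)) * (x * y) ^ (3 / 8 : ℝ)) ≤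
      d * (x + y) ^ (1 / 4 : ℝ) * (x * y) ^ (1 / 4 : ℝ) := by
  have hs1 : 1 ≤ x + y := by linarith
  have hp1 : 1 ≤ x * y := by nlinarith
  have ht0 : 0 < d ^ (-(1 / 2 : ℝ)) * (x + y) ^ (-(1 / 8 : ℝ)) * (x * y) ^ (3 / 8 : ℝ) := by positivity
  rw [div_le_iff₀ ht0]
  have h1 : d ≤ d * (x + y) ^ (1 / 4 : ℝ) * (x * y) ^ (1 / 4 : ℝ) := by
    have : (1 : ℝ) ≤ (x + y) ^ (1 / 4 : ℝ) * (x * y) ^ (1 / 4 : ℝ) :=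
      one_le_mul_of_one_le_of_one_le (Real.one_le_rpow hs1 (by norm_num)) (Real.one_le_rpow hp1 (by norm_num))
    calc d = d * 1 := (mul_one d).symm
      _ ≤ d * ((x + y) ^ (1 / 4 : ℝ) * (x * y) ^ (1 / 4 : ℝ)) := mul_le_mul_of_nonneg_left this hd.le
      _ = _ := by ring
  calc d ≤ d * (x + y) ^ (1 / 4 : ℝ) * (x * y) ^ (1 / 4 : ℝ) := h1
    _ = d * (x + y) ^ (1 / 4 : ℝ) * (x * y) ^ (1 / 4 : ℝ) * 1 := (mul_one _).symm
    _ ≤ _ := mul_le_mul_of_nonneg_left ht (by positivity)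

/-- Term (f1): `xy / t² = T₁`. [folklore] -/
private theorem term_f1 (hd : 0 < d) (hx : 1 ≤ x) (hy : 1 ≤ y) :
    x * y / (d ^ (-(1 / 2 : ℝ)) * (x + y) ^ (-(1 / 8 : ℝ)) * (x * y) ^ (3 / 8 : ℝ)) ^ 2 =
      d * (x + y) ^ (1 / 4 : ℝ) * (x * y) ^ (1 / 4 : ℝ) := by
  have hs0 : 0 < x + y := by linarith
  have hp0 : 0 < x * y := mul_pos (by linarith) (by linarith)
  rw [t_sq hd hx hy, div_eq_mul_inv, mul_inv, inv_inv, mul_inv, ← Real.rpow_neg hs0.le, neg_neg,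
    ← Real.rpow_neg hp0.le]
  have h2 : x * y * (x * y) ^ (-(3 / 4 : ℝ)) = (x * y) ^ (1 / 4 : ℝ) := by
    have h := Real.rpow_add hp0 1 (-(3 / 4 : ℝ))
    rw [Real.rpow_one] at h
    rw [← h]; norm_num
  calc x * y * (d * ((x + y) ^ (1 / 4 : ℝ) * (x * y) ^ (-(3 / 4 : ℝ))))
      = d * (x + y) ^ (1 / 4 : ℝ) * (x * y * (x * y) ^ (-(3 / 4 : ℝ))) := by ring
    _ = _ := by rw [h2]

/-- `(x+y)^{1/4}(xy)^{3/4} ≤ T₂` when `t ≥ 1` (so `y/t ≤ y ≤ T₂`, term (f2)). [folklore] -/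
private theorem quarter_mul_le_T₂ (hx : 1 ≤ x) (hy : 1 ≤ y)
    (ht : 1 ≤ d ^ (-(1 / 2 : ℝ)) * (x + y) ^ (-(1 / 8 : ℝ)) * (x * y) ^ (3 / 8 : ℝ)) :
    (x + y) ^ (1 / 4 : ℝ) * (x * y) ^ (3 / 4 : ℝ) ≤
      d ^ (-(1 / 2 : ℝ)) * (x + y) ^ (1 / 8 : ℝ) * (x * y) ^ (9 / 8 : ℝ) := by
  rw [← term_d hx hy]
  exact le_mul_of_one_le_left (by positivity) ht

/-- `y ≤ (x+y)^{1/4}(xy)^{3/4}` and `x ≤ (x+y)^{1/4}(xy)^{3/4}` for `x, y ≥ 1`. [folklore] -/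
private theorem le_quarter_mul (hx : 1 ≤ x) (hy : 1 ≤ y) :
    y ≤ (x + y) ^ (1 / 4 : ℝ) * (x * y) ^ (3 / 4 : ℝ) ∧ x ≤ (x + y) ^ (1 / 4 : ℝ) * (x * y) ^ (3 / 4 : ℝ) := by
  have hx0 : 0 < x := by linarith
  have hy0 : 0 < y := by linarith
  have hp0 : 0 < x * y := mul_pos hx0 hy0
  constructor
  · calc y = y ^ (1 / 4 : ℝ) * y ^ (3 / 4 : ℝ) := by rw [← Real.rpow_add hy0]; norm_num
      _ ≤ (x + y) ^ (1 / 4 : ℝ) * (x * y) ^ (3 / 4 : ℝ) :=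
          mul_le_mul (Real.rpow_le_rpow hy0.le (by linarith) (by norm_num))
            (Real.rpow_le_rpow hy0.le (by nlinarith) (by norm_num)) (by positivity) (by positivity)
  · calc x = x ^ (1 / 4 : ℝ) * x ^ (3 / 4 : ℝ) := by rw [← Real.rpow_add hx0]; norm_num
      _ ≤ (x + y) ^ (1 / 4 : ℝ) * (x * y) ^ (3 / 4 : ℝ) :=
          mul_le_mul (Real.rpow_le_rpow hx0.le (by linarith) (by norm_num))
            (Real.rpow_le_rpow hx0.le (by nlinarith) (by norm_num)) (by positivity) (by positivity)

/-- Case A (`d ≤ (x+y)^{1/4}(xy)^{1/4}`): `xy ≤ T₂`, hence Proposition 11.1's terms are `≤ 5T₂`: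
`d^{-1/2}xy + d√(xy) + x y^{3/4} + y x^{3/4} ≤ 7 T₂`. [folklore] -/
private theorem caseA_bound (hd : 0 < d) (hx : 1 ≤ x) (hy : 1 ≤ y)
    (hA : d ≤ (x + y) ^ (1 / 4 : ℝ) * (x * y) ^ (1 / 4 : ℝ)) :
    x * y / Real.sqrt d + d * Real.sqrt (x * y) + x * y ^ (3 / 4 : ℝ) + y * x ^ (3 / 4 : ℝ) ≤
      7 * (d ^ (-(1 / 2 : ℝ)) * (x + y) ^ (1 / 8 : ℝ) * (x * y) ^ (9 / 8 : ℝ)) := by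
  have hs0 : 0 < x + y := by linarith
  have hs1 : 1 ≤ x + y := by linarith
  have hp0 : 0 < x * y := mul_pos (by linarith) (by linarith)
  have hp1 : 1 ≤ x * y := by nlinarith
  set T₂ := d ^ (-(1 / 2 : ℝ)) * (x + y) ^ (1 / 8 : ℝ) * (x * y) ^ (9 / 8 : ℝ) with hT₂
  -- `xy ≤ T₂`: `d^{1/2} ≤ (x+y)^{1/8}(xy)^{1/8}`
  have hdhalf : d ^ (1 / 2 : ℝ) ≤ (x + y) ^ (1 / 8 : ℝ) * (x * y) ^ (1 / 8 : ℝ) := by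
    calc d ^ (1 / 2 : ℝ) ≤ ((x + y) ^ (1 / 4 : ℝ) * (x * y) ^ (1 / 4 : ℝ)) ^ (1 / 2 : ℝ) :=
          Real.rpow_le_rpow hd.le hA (by norm_num)
      _ = (x + y) ^ (1 / 8 : ℝ) * (x * y) ^ (1 / 8 : ℝ) := by
          rw [Real.mul_rpow (by positivity) (by positivity), ← Real.rpow_mul hs0.le, ← Real.rpow_mul hp0.le]
          norm_num
  have hpT : x * y ≤ T₂ := by
    -- `xy = d^{-1/2} d^{1/2} xy ≤ d^{-1/2} (x+y)^{1/8}(xy)^{1/8} xy = T₂`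
    have e : x * y = d ^ (-(1 / 2 : ℝ)) * (d ^ (1 / 2 : ℝ) * (x * y)) := by
      rw [← mul_assoc, ← Real.rpow_add hd]; norm_num
    have e2 : d ^ (-(1 / 2 : ℝ)) * ((x + y) ^ (1 / 8 : ℝ) * (x * y) ^ (1 / 8 : ℝ) * (x * y)) = T₂ := by
      rw [hT₂]
      have : (x * y) ^ (1 / 8 : ℝ) * (x * y) = (x * y) ^ (9 / 8 : ℝ) := by
        have h := Real.rpow_add hp0 (1 / 8 : ℝ) 1
        rw [Real.rpow_one] at h; rw [← h]; norm_num
      rw [mul_assoc ((x + y) ^ (1 / 8 : ℝ)), this]; ring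
    rw [e, ← e2]
    exact mul_le_mul_of_nonneg_left (mul_le_mul_of_nonneg_right hdhalf hp0.le) (by positivity)
  -- `xy/√d ≤ T₂`
  have h1 : x * y / Real.sqrt d ≤ T₂ := by
    rw [Real.sqrt_eq_rpow, div_eq_mul_inv, ← Real.rpow_neg hd.le, hT₂]
    calc x * y * d ^ (-(1 / 2 : ℝ)) = d ^ (-(1 / 2 : ℝ)) * 1 * (x * y) := by ring
      _ ≤ d ^ (-(1 / 2 : ℝ)) * (x + y) ^ (1 / 8 : ℝ) * (x * y) ^ (9 / 8 : ℝ) := by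
          refine mul_le_mul (mul_le_mul_of_nonneg_left (Real.one_le_rpow hs1 (by norm_num)) (by positivity))
            ?_ hp0.le (by positivity)
          calc x * y = (x * y) ^ (1 : ℝ) := (Real.rpow_one _).symm
            _ ≤ (x * y) ^ (9 / 8 : ℝ) := Real.rpow_le_rpow_of_exponent_le hp1 (by norm_num)
  -- `d √(xy) ≤ (x+y)^{1/4}(xy)^{3/4} ≤ 2xy ≤ 2T₂`
  have h2 : d * Real.sqrt (x * y) ≤ 2 * T₂ := by
    calc d * Real.sqrt (x * y) ≤ (x + y) ^ (1 / 4 : ℝ) * (x * y) ^ (1 / 4 : ℝ) * Real.sqrt (x * y) :=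
          mul_le_mul_of_nonneg_right hA (Real.sqrt_nonneg _)
      _ = (x + y) ^ (1 / 4 : ℝ) * (x * y) ^ (3 / 4 : ℝ) := by
          rw [Real.sqrt_eq_rpow, mul_assoc, ← Real.rpow_add hp0]; norm_num
      _ ≤ 2 * (x * y) := quarter_mul_le_two_mul hx hy
      _ ≤ 2 * T₂ := by linarith
  have h3 : x * y ^ (3 / 4 : ℝ) + y * x ^ (3 / 4 : ℝ) ≤ 4 * T₂ := by
    have := cross_le_two_mul hx hy
    have := quarter_mul_le_two_mul hx hy
    linarith
  linarith

/-- Case B (`t < P₁`, `P₁ ≥ 1`): `xy ≤ P₁² T₁`, hence the terms of (12.4) at level `d` satisfy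
`d ≤ T₁`, `d^{1/3}(xy)^{2/3} ≤ P₁² T₁`, `d⁻¹(xy)^{3/2} ≤ 2P₁⁴ T₁`, `x y^{3/4} + y x^{3/4} ≤ 4P₁² T₁`.
[folklore] -/
private theorem caseB_bound (hd : 1 ≤ d) (hx : 1 ≤ x) (hy : 1 ≤ y) {P₁ : ℝ} (hP₁ : 1 ≤ P₁)
    (hB : d ^ (-(1 / 2 : ℝ)) * (x + y) ^ (-(1 / 8 : ℝ)) * (x * y) ^ (3 / 8 : ℝ) ≤ P₁) :
    d ≤ d * (x + y) ^ (1 / 4 : ℝ) * (x * y) ^ (1 / 4 : ℝ) ∧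
    d ^ (1 / 3 : ℝ) * (x * y) ^ (2 / 3 : ℝ) ≤ P₁ ^ 2 * (d * (x + y) ^ (1 / 4 : ℝ) * (x * y) ^ (1 / 4 : ℝ)) ∧
    d⁻¹ * (x * y) ^ (3 / 2 : ℝ) ≤ 2 * P₁ ^ 4 * (d * (x + y) ^ (1 / 4 : ℝ) * (x * y) ^ (1 / 4 : ℝ)) ∧
    x * y ^ (3 / 4 : ℝ) + y * x ^ (3 / 4 : ℝ) ≤ 4 * P₁ ^ 2 * (d * (x + y) ^ (1 / 4 : ℝ) * (x * y) ^ (1 / 4 : ℝ)) := by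
  have hd0 : 0 < d := by linarith
  have hs0 : 0 < x + y := by linarith
  have hs1 : 1 ≤ x + y := by linarith
  have hp0 : 0 < x * y := mul_pos (by linarith) (by linarith)
  have hp1 : 1 ≤ x * y := by nlinarith
  set T₁ := d * (x + y) ^ (1 / 4 : ℝ) * (x * y) ^ (1 / 4 : ℝ) with hT₁
  have hT₁0 : 0 < T₁ := by positivity
  -- from `t ≤ P₁`: `t² ≤ P₁²`, i.e. `d⁻¹ (x+y)^{-1/4}(xy)^{3/4} ≤ P₁²`, i.e. `(x+y)^{-1/4}(xy)^{3/4} ≤ P₁² d`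
  have ht0 : 0 ≤ d ^ (-(1 / 2 : ℝ)) * (x + y) ^ (-(1 / 8 : ℝ)) * (x * y) ^ (3 / 8 : ℝ) := by positivity
  have hsq : d⁻¹ * ((x + y) ^ (-(1 / 4 : ℝ)) * (x * y) ^ (3 / 4 : ℝ)) ≤ P₁ ^ 2 := by
    rw [← t_sq hd0 hx hy]
    exact pow_le_pow_left₀ ht0 hB 2
  have hW : (x + y) ^ (-(1 / 4 : ℝ)) * (x * y) ^ (3 / 4 : ℝ) ≤ P₁ ^ 2 * d := by
    have h := hsq
    rw [inv_mul_le_iff₀ hd0] at h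
    linarith
  -- `xy ≤ P₁² T₁`: multiply `hW` by `(x+y)^{1/4}(xy)^{1/4}`
  have hpT : x * y ≤ P₁ ^ 2 * T₁ := by
    have e1 : (x + y) ^ (-(1 / 4 : ℝ)) * (x * y) ^ (3 / 4 : ℝ) * ((x + y) ^ (1 / 4 : ℝ) * (x * y) ^ (1 / 4 : ℝ)) =
        x * y := by
      calc (x + y) ^ (-(1 / 4 : ℝ)) * (x * y) ^ (3 / 4 : ℝ) * ((x + y) ^ (1 / 4 : ℝ) * (x * y) ^ (1 / 4 : ℝ))
          = ((x + y) ^ (-(1 / 4 : ℝ)) * (x + y) ^ (1 / 4 : ℝ)) * ((x * y) ^ (3 / 4 : ℝ) * (x * y) ^ (1 / 4 : ℝ)) := by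
            ring
        _ = x * y := by
            rw [← Real.rpow_add hs0, ← Real.rpow_add hp0]; norm_num
    have := mul_le_mul_of_nonneg_right hW
      (by positivity : (0 : ℝ) ≤ (x + y) ^ (1 / 4 : ℝ) * (x * y) ^ (1 / 4 : ℝ))
    rw [e1] at this
    calc x * y ≤ P₁ ^ 2 * d * ((x + y) ^ (1 / 4 : ℝ) * (x * y) ^ (1 / 4 : ℝ)) := this
      _ = P₁ ^ 2 * T₁ := by rw [hT₁]; ring
  have hq1 : (1 : ℝ) ≤ (x + y) ^ (1 / 4 : ℝ) * (x * y) ^ (1 / 4 : ℝ) :=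
    one_le_mul_of_one_le_of_one_le (Real.one_le_rpow hs1 (by norm_num)) (Real.one_le_rpow hp1 (by norm_num))
  have hdT : d ≤ T₁ := by
    calc d = d * 1 := (mul_one d).symm
      _ ≤ d * ((x + y) ^ (1 / 4 : ℝ) * (x * y) ^ (1 / 4 : ℝ)) := mul_le_mul_of_nonneg_left hq1 hd0.le
      _ = T₁ := by rw [hT₁]; ring
  refine ⟨hdT, ?_, ?_, ?_⟩
  · -- `d^{1/3}(xy)^{2/3} ≤ (d + 2xy)/3`-free route: `d^{1/3}(xy)^{2/3} = d^{1/3} ((xy))^{2/3} ≤ T₁^{1/3} (P₁² T₁)^{2/3} ≤ P₁² T₁`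
    have h1 : d ^ (1 / 3 : ℝ) ≤ T₁ ^ (1 / 3 : ℝ) := Real.rpow_le_rpow hd0.le hdT (by norm_num)
    have h2 : (x * y) ^ (2 / 3 : ℝ) ≤ (P₁ ^ 2 * T₁) ^ (2 / 3 : ℝ) := Real.rpow_le_rpow hp0.le hpT (by norm_num)
    have hP2 : (1 : ℝ) ≤ P₁ ^ 2 := one_le_pow₀ hP₁
    calc d ^ (1 / 3 : ℝ) * (x * y) ^ (2 / 3 : ℝ) ≤ T₁ ^ (1 / 3 : ℝ) * (P₁ ^ 2 * T₁) ^ (2 / 3 : ℝ) :=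
          mul_le_mul h1 h2 (by positivity) (by positivity)
      _ = (P₁ ^ 2) ^ (2 / 3 : ℝ) * (T₁ ^ (1 / 3 : ℝ) * T₁ ^ (2 / 3 : ℝ)) := by
          rw [Real.mul_rpow (by positivity) hT₁0.le]; ring
      _ = (P₁ ^ 2) ^ (2 / 3 : ℝ) * T₁ := by rw [← Real.rpow_add hT₁0]; norm_num
      _ ≤ P₁ ^ 2 * T₁ := by
          refine mul_le_mul_of_nonneg_right ?_ hT₁0.le
          calc (P₁ ^ 2) ^ (2 / 3 : ℝ) ≤ (P₁ ^ 2) ^ (1 : ℝ) :=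
                Real.rpow_le_rpow_of_exponent_le hP2 (by norm_num)
            _ = P₁ ^ 2 := Real.rpow_one _
  · -- `d⁻¹ (xy)^{3/2} ≤ P₁² (x+y)^{1/4}(xy)^{3/4} ≤ 2P₁² xy ≤ 2P₁⁴ T₁`
    have h1 : d⁻¹ * (x * y) ^ (3 / 2 : ℝ) ≤ P₁ ^ 2 * ((x + y) ^ (1 / 4 : ℝ) * (x * y) ^ (3 / 4 : ℝ)) := by
      -- `d⁻¹ (xy)^{3/2} = d⁻¹ (x+y)^{-1/4}(xy)^{3/4} · (x+y)^{1/4}(xy)^{3/4}`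
      have e : d⁻¹ * (x * y) ^ (3 / 2 : ℝ) =
          d⁻¹ * ((x + y) ^ (-(1 / 4 : ℝ)) * (x * y) ^ (3 / 4 : ℝ)) * ((x + y) ^ (1 / 4 : ℝ) * (x * y) ^ (3 / 4 : ℝ)) := by
        have h3 : (x * y) ^ (3 / 2 : ℝ) = (x * y) ^ (3 / 4 : ℝ) * (x * y) ^ (3 / 4 : ℝ) := by
          rw [← Real.rpow_add hp0]; norm_num
        have h4 : (x + y) ^ (-(1 / 4 : ℝ)) * (x + y) ^ (1 / 4 : ℝ) = 1 := by
          rw [← Real.rpow_add hs0]; norm_num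
        rw [h3]
        calc d⁻¹ * ((x * y) ^ (3 / 4 : ℝ) * (x * y) ^ (3 / 4 : ℝ))
            = d⁻¹ * ((x + y) ^ (-(1 / 4 : ℝ)) * (x + y) ^ (1 / 4 : ℝ)) *
                ((x * y) ^ (3 / 4 : ℝ) * (x * y) ^ (3 / 4 : ℝ)) := by rw [h4]; ring
          _ = _ := by ring
      rw [e]
      exact mul_le_mul_of_nonneg_right hsq (by positivity)
    have := quarter_mul_le_two_mul hx hy
    have hP2 : (0 : ℝ) ≤ P₁ ^ 2 := by positivity
    calc d⁻¹ * (x * y) ^ (3 / 2 : ℝ) ≤ P₁ ^ 2 * ((x + y) ^ (1 / 4 : ℝ) * (x * y) ^ (3 / 4 : ℝ)) := h1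
      _ ≤ P₁ ^ 2 * (2 * (x * y)) := mul_le_mul_of_nonneg_left this hP2
      _ ≤ P₁ ^ 2 * (2 * (P₁ ^ 2 * T₁)) := by gcongr
      _ = 2 * P₁ ^ 4 * T₁ := by ring
  · have := cross_le_two_mul hx hy
    have := quarter_mul_le_two_mul hx hy
    have hP2 : (0 : ℝ) ≤ P₁ ^ 2 := by positivity
    calc x * y ^ (3 / 4 : ℝ) + y * x ^ (3 / 4 : ℝ) ≤ 4 * (x * y) := by linarith
      _ ≤ 4 * (P₁ ^ 2 * T₁) := by gcongr
      _ = 4 * P₁ ^ 2 * T₁ := by ring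

/-- Absorbing logarithms: for `0 < a`, `1 ≤ u`: `log(8u) ≤ a⁻¹ (8u)^a`, hence
`log(8u)^6 ≤ a^{-6} 8^{6a} u^{6a}`. We use it with `6a = ε/2`. [folklore] -/
private theorem log_pow_six_le {u a : ℝ} (hu : 1 ≤ u) (ha : 0 < a) (ha1 : 6 * a ≤ 1) :
    Real.log (8 * u) ^ 6 ≤ 8 * a⁻¹ ^ 6 * u ^ (6 * a) := by
  have hu0 : 0 < u := by linarith
  have h8u : 0 ≤ 8 * u := by linarith
  have hl0 : 0 ≤ Real.log (8 * u) := Real.log_nonneg (by linarith)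
  have h1 : Real.log (8 * u) ≤ (8 * u) ^ a / a := Real.log_le_rpow_div h8u ha
  have h2 : Real.log (8 * u) ^ 6 ≤ ((8 * u) ^ a / a) ^ 6 := pow_le_pow_left₀ hl0 h1 6
  have h3 : ((8 * u) ^ a / a) ^ 6 = a⁻¹ ^ 6 * ((8 : ℝ) ^ (6 * a) * u ^ (6 * a)) := by
    rw [div_eq_mul_inv, mul_pow, ← Real.rpow_natCast ((8 * u) ^ a), ← Real.rpow_mul h8u,
      Real.mul_rpow (by norm_num) hu0.le]
    push_cast; ring_nf
  have h4 : (8 : ℝ) ^ (6 * a) ≤ 8 := by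
    calc (8 : ℝ) ^ (6 * a) ≤ (8 : ℝ) ^ (1 : ℝ) := Real.rpow_le_rpow_of_exponent_le (by norm_num) ha1
      _ = 8 := Real.rpow_one 8
  calc Real.log (8 * u) ^ 6 ≤ a⁻¹ ^ 6 * ((8 : ℝ) ^ (6 * a) * u ^ (6 * a)) := h2.trans_eq h3
    _ ≤ a⁻¹ ^ 6 * (8 * u ^ (6 * a)) := by gcongr
    _ = 8 * a⁻¹ ^ 6 * u ^ (6 * a) := by ring

/-- `log 2 ≥ 1/2` and `log 8 ≥ 1` (from `e < 3`). [folklore] -/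
private theorem half_le_log_two : (1 / 2 : ℝ) ≤ Real.log 2 ∧ (1 : ℝ) ≤ Real.log 8 := by
  have he := Real.exp_one_lt_three
  constructor
  · rw [Real.le_log_iff_exp_le (by norm_num)]
    have hpos := Real.exp_pos (1 / 2 : ℝ)
    have hsq : Real.exp (1 / 2 : ℝ) * Real.exp (1 / 2 : ℝ) = Real.exp 1 := by
      rw [← Real.exp_add]; norm_num
    nlinarith
  · rw [Real.le_log_iff_exp_le (by norm_num)]
    linarith

end RealIneq131

/-- The three enlarged levels `2^jDP²`, `j ≤ 2`: each is `≥ 1`, `≤ 4DP²` and `≥ DP²`. [folklore] -/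
private theorem level_facts {D P : ℕ} (hD : 1 ≤ D) (hP : 1 ≤ P) {j : ℕ} (hj : j ≤ 2) :
    1 ≤ 2 ^ j * (D * P ^ 2) ∧ ((2 ^ j * (D * P ^ 2) : ℕ) : ℝ) ≤ 4 * ((D : ℝ) * (P : ℝ) ^ 2) ∧
      (D : ℝ) * (P : ℝ) ^ 2 ≤ ((2 ^ j * (D * P ^ 2) : ℕ) : ℝ) := by
  have hDP0 : (0 : ℝ) ≤ (D : ℝ) * (P : ℝ) ^ 2 := by positivity
  refine ⟨Nat.one_le_iff_ne_zero.mpr (by positivity), ?_, ?_⟩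
  · have h2j : (2 : ℝ) ^ j ≤ 4 := by
      interval_cases j <;> norm_num
    push_cast
    nlinarith
  · have h2j : (1 : ℝ) ≤ (2 : ℝ) ^ j := one_le_pow₀ (by norm_num)
    push_cast
    nlinarith

/-! ### Proposition 13.1 from Proposition 12.1 -/

/-- `‖α‖² ≤ Σ τ(r)|α_{rs}|²` (`τ(r) ≥ 1`). [folklore] -/
private theorem normSq_le_tau_normSq' (R S : ℕ) (α : ℕ → ℕ → ℂ) :
    ∑ r ∈ Ioc R (2 * R), ∑ s ∈ Ioc S (2 * S), ‖α r s‖ ^ 2 ≤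
      ∑ r ∈ Ioc R (2 * R), ∑ s ∈ Ioc S (2 * S), (σ 0 r : ℝ) * ‖α r s‖ ^ 2 := by
  refine Finset.sum_le_sum fun r hr => Finset.sum_le_sum fun s _ => ?_
  have hr0 : r ≠ 0 := by have := (Finset.mem_Ioc.mp hr).1; omega
  have h1 : (1 : ℝ) ≤ (σ 0 r : ℝ) := by
    rw [ArithmeticFunction.sigma_zero_apply]
    exact_mod_cast Finset.card_pos.mpr ⟨1, Nat.one_mem_divisors.mpr hr0⟩
  nlinarith [norm_nonneg (α r s), sq_nonneg ‖α r s‖]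

/-- The multiplicity factor: for `P ≥ 2` and `1 ≤ D ≤ u`,
`(1 + ⌊log_P(8D)/2⌋ : ℕ) ≤ 1 + 2 log(8u)`. [folklore] -/
private theorem multiplicity_le {P D : ℕ} (hP : 2 ≤ P) (hD : 1 ≤ D) {u : ℝ} (hu : (D : ℝ) ≤ u) :
    ((1 + Nat.log P (8 * D) / 2 : ℕ) : ℝ) ≤ 1 + 2 * Real.log (8 * u) := by
  have hn : (Nat.log P (8 * D) : ℝ) ≤ 2 * Real.log (8 * u) := by
    set n := Nat.log P (8 * D) with hn
    have hpow : P ^ n ≤ 8 * D := Nat.pow_log_le_self P (by omega)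
    have hpowR : (P : ℝ) ^ n ≤ 8 * u := by
      calc (P : ℝ) ^ n = ((P ^ n : ℕ) : ℝ) := by push_cast; ring
        _ ≤ ((8 * D : ℕ) : ℝ) := by exact_mod_cast hpow
        _ = 8 * (D : ℝ) := by push_cast; ring
        _ ≤ 8 * u := by linarith
    have hP0 : (0 : ℝ) < P := by positivity
    have hlog : (n : ℝ) * Real.log P ≤ Real.log (8 * u) := by
      rw [← Real.log_pow]
      exact Real.log_le_log (by positivity) hpowR
    have hlogP : (1 / 2 : ℝ) ≤ Real.log P :=
      half_le_log_two.1.trans (Real.log_le_log (by norm_num) (by exact_mod_cast hP))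
    have hn0 : (0 : ℝ) ≤ n := Nat.cast_nonneg _
    nlinarith
  have hdiv : ((1 + Nat.log P (8 * D) / 2 : ℕ) : ℝ) ≤ 1 + (Nat.log P (8 * D) : ℝ) := by
    have : Nat.log P (8 * D) / 2 ≤ Nat.log P (8 * D) := Nat.div_le_self _ _
    push_cast
    have : ((Nat.log P (8 * D) / 2 : ℕ) : ℝ) ≤ (Nat.log P (8 * D) : ℝ) := by exact_mod_cast this
    linarith
  linarith

/-- Case C, the three enlarged levels: with `t ≤ P ≤ 2t`, `dP² ≤ D_j ≤ 4dP²`,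
`0 ≤ lg ≤ ℓ₄`, `ℓ₄ ≥ 1`, `e ≥ 1`,
`P {D_j + D_j^{1/3}(xy)^{2/3} lg + (D_j⁻¹(xy)^{3/2} + x y^{3/4} + y x^{3/4}) e} ≤ 45 T₂ ℓ₄ e`
(terms (a)–(d)). [folklore] -/
private theorem caseC_level_bound {d x y t P Dj lg ℓ₄ e : ℝ} (hd0 : 0 < d) (hx1 : 1 ≤ x) (hy1 : 1 ≤ y)
    (ht : t = d ^ (-(1 / 2 : ℝ)) * (x + y) ^ (-(1 / 8 : ℝ)) * (x * y) ^ (3 / 8 : ℝ)) (ht0 : 0 < t)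
    (hPt : t ≤ P) (hP2t : P ≤ 2 * t) (hDj1 : d * P ^ 2 ≤ Dj) (hDj4 : Dj ≤ 4 * (d * P ^ 2))
    (hlg0 : 0 ≤ lg) (hlg : lg ≤ ℓ₄) (hℓ41 : 1 ≤ ℓ₄) (he1 : 1 ≤ e) :
    P * (Dj + Dj ^ (1 / 3 : ℝ) * (x * y) ^ (2 / 3 : ℝ) * lg +
        (Dj⁻¹ * (x * y) ^ (3 / 2 : ℝ) + x * y ^ (3 / 4 : ℝ) + y * x ^ (3 / 4 : ℝ)) * e) ≤
      45 * (d ^ (-(1 / 2 : ℝ)) * (x + y) ^ (1 / 8 : ℝ) * (x * y) ^ (9 / 8 : ℝ)) * ℓ₄ * e := by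
  have hp0 : 0 < x * y := mul_pos (by linarith) (by linarith)
  have hPr0 : 0 < P := lt_of_lt_of_le ht0 hPt
  have hDP0 : 0 < d * P ^ 2 := by positivity
  have hDj0 : 0 < Dj := lt_of_lt_of_le hDP0 hDj1
  set T₂ : ℝ := d ^ (-(1 / 2 : ℝ)) * (x + y) ^ (1 / 8 : ℝ) * (x * y) ^ (9 / 8 : ℝ) with hT₂
  have hT₂0 : 0 ≤ T₂ := by positivity
  have he0 : 0 ≤ e := le_trans zero_le_one he1
  -- (a)
  have ha' : P * Dj ≤ 32 * T₂ := by
    have h2 : P ^ 3 ≤ (2 * t) ^ 3 := pow_le_pow_left₀ hPr0.le hP2t 3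
    have h3 : d * t ^ 3 ≤ T₂ := by rw [hT₂, ht]; exact term_a hd0 hx1 hy1
    calc P * Dj ≤ P * (4 * (d * P ^ 2)) := mul_le_mul_of_nonneg_left hDj4 hPr0.le
      _ = 4 * d * P ^ 3 := by ring
      _ ≤ 4 * d * (2 * t) ^ 3 := mul_le_mul_of_nonneg_left h2 (by positivity)
      _ = 32 * (d * t ^ 3) := by ring
      _ ≤ 32 * T₂ := by linarith only [h3]
  -- (b)
  have hb' : P * (Dj ^ (1 / 3 : ℝ) * (x * y) ^ (2 / 3 : ℝ)) ≤ 8 * T₂ := by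
    have h1 : Dj ^ (1 / 3 : ℝ) ≤ (4 * (d * P ^ 2)) ^ (1 / 3 : ℝ) :=
      Real.rpow_le_rpow hDj0.le hDj4 (by norm_num)
    have h2 : (4 * (d * P ^ 2)) ^ (1 / 3 : ℝ) = (4 : ℝ) ^ (1 / 3 : ℝ) * d ^ (1 / 3 : ℝ) * P ^ (2 / 3 : ℝ) := by
      rw [Real.mul_rpow (by norm_num) hDP0.le, Real.mul_rpow hd0.le (by positivity),
        ← Real.rpow_natCast P, ← Real.rpow_mul hPr0.le]
      norm_num; ring
    have h4 : (4 : ℝ) ^ (1 / 3 : ℝ) ≤ 2 := by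
      have : (4 : ℝ) ≤ 2 ^ (3 : ℝ) := by norm_num
      calc (4 : ℝ) ^ (1 / 3 : ℝ) ≤ ((2 : ℝ) ^ (3 : ℝ)) ^ (1 / 3 : ℝ) :=
            Real.rpow_le_rpow (by norm_num) this (by norm_num)
        _ = 2 := by rw [← Real.rpow_mul (by norm_num)]; norm_num
    have h5 : P * P ^ (2 / 3 : ℝ) = P ^ (5 / 3 : ℝ) := by
      have h := Real.rpow_add hPr0 1 (2 / 3 : ℝ)
      rw [Real.rpow_one] at h; rw [← h]; norm_num
    have h6 : P ^ (5 / 3 : ℝ) ≤ 4 * t ^ (5 / 3 : ℝ) := by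
      calc P ^ (5 / 3 : ℝ) ≤ (2 * t) ^ (5 / 3 : ℝ) := Real.rpow_le_rpow hPr0.le hP2t (by norm_num)
        _ = (2 : ℝ) ^ (5 / 3 : ℝ) * t ^ (5 / 3 : ℝ) := Real.mul_rpow (by norm_num) ht0.le
        _ ≤ 4 * t ^ (5 / 3 : ℝ) := by
            refine mul_le_mul_of_nonneg_right ?_ (by positivity)
            calc (2 : ℝ) ^ (5 / 3 : ℝ) ≤ (2 : ℝ) ^ (2 : ℝ) :=
                  Real.rpow_le_rpow_of_exponent_le (by norm_num) (by norm_num)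
              _ = 4 := by norm_num
    have h7 : d ^ (1 / 3 : ℝ) * t ^ (5 / 3 : ℝ) * (x * y) ^ (2 / 3 : ℝ) ≤ T₂ := by
      rw [hT₂, ht]; exact term_b hd0 hx1 hy1
    calc P * (Dj ^ (1 / 3 : ℝ) * (x * y) ^ (2 / 3 : ℝ))
        ≤ P * ((4 : ℝ) ^ (1 / 3 : ℝ) * d ^ (1 / 3 : ℝ) * P ^ (2 / 3 : ℝ) * (x * y) ^ (2 / 3 : ℝ)) := by
          rw [← h2]; exact mul_le_mul_of_nonneg_left (mul_le_mul_of_nonneg_right h1 (by positivity)) hPr0.le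
      _ = (4 : ℝ) ^ (1 / 3 : ℝ) * (P * P ^ (2 / 3 : ℝ)) * (d ^ (1 / 3 : ℝ) * (x * y) ^ (2 / 3 : ℝ)) := by ring
      _ ≤ 2 * (4 * t ^ (5 / 3 : ℝ)) * (d ^ (1 / 3 : ℝ) * (x * y) ^ (2 / 3 : ℝ)) := by
          rw [h5]
          exact mul_le_mul_of_nonneg_right (mul_le_mul h4 h6 (by positivity) (by norm_num)) (by positivity)
      _ = 8 * (d ^ (1 / 3 : ℝ) * t ^ (5 / 3 : ℝ) * (x * y) ^ (2 / 3 : ℝ)) := by ring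
      _ ≤ 8 * T₂ := by linarith only [h7]
  -- (c)
  have hc' : P * (Dj⁻¹ * (x * y) ^ (3 / 2 : ℝ)) ≤ T₂ := by
    have h1 : Dj⁻¹ ≤ (d * P ^ 2)⁻¹ := inv_anti₀ hDP0 hDj1
    have h2 : P * (d * P ^ 2)⁻¹ = d⁻¹ * P⁻¹ := by
      field_simp
    have h3 : P⁻¹ ≤ t⁻¹ := inv_anti₀ ht0 hPt
    calc P * (Dj⁻¹ * (x * y) ^ (3 / 2 : ℝ)) ≤ P * ((d * P ^ 2)⁻¹ * (x * y) ^ (3 / 2 : ℝ)) :=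
          mul_le_mul_of_nonneg_left (mul_le_mul_of_nonneg_right h1 (by positivity)) hPr0.le
      _ = d⁻¹ * P⁻¹ * (x * y) ^ (3 / 2 : ℝ) := by rw [← mul_assoc, h2]
      _ ≤ d⁻¹ * t⁻¹ * (x * y) ^ (3 / 2 : ℝ) :=
          mul_le_mul_of_nonneg_right (mul_le_mul_of_nonneg_left h3 (by positivity)) (by positivity)
      _ = T₂ := by rw [hT₂, ht]; exact term_c hd0 hx1 hy1
  -- (d)
  have hd' : P * (x * y ^ (3 / 4 : ℝ) + y * x ^ (3 / 4 : ℝ)) ≤ 4 * T₂ := by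
    have h1 := cross_le_two_mul hx1 hy1
    have h2 : t * ((x + y) ^ (1 / 4 : ℝ) * (x * y) ^ (3 / 4 : ℝ)) = T₂ := by rw [hT₂, ht]; exact term_d hx1 hy1
    calc P * (x * y ^ (3 / 4 : ℝ) + y * x ^ (3 / 4 : ℝ))
        ≤ (2 * t) * (2 * ((x + y) ^ (1 / 4 : ℝ) * (x * y) ^ (3 / 4 : ℝ))) :=
          mul_le_mul hP2t h1 (by positivity) (by positivity)
      _ = 4 * (t * ((x + y) ^ (1 / 4 : ℝ) * (x * y) ^ (3 / 4 : ℝ))) := by ring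
      _ = 4 * T₂ := by rw [h2]
  -- assemble
  have e0 : P * (Dj + Dj ^ (1 / 3 : ℝ) * (x * y) ^ (2 / 3 : ℝ) * lg +
      (Dj⁻¹ * (x * y) ^ (3 / 2 : ℝ) + x * y ^ (3 / 4 : ℝ) + y * x ^ (3 / 4 : ℝ)) * e) =
      P * Dj + P * (Dj ^ (1 / 3 : ℝ) * (x * y) ^ (2 / 3 : ℝ)) * lg +
      (P * (Dj⁻¹ * (x * y) ^ (3 / 2 : ℝ)) + P * (x * y ^ (3 / 4 : ℝ) + y * x ^ (3 / 4 : ℝ))) * e := by ring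
  rw [e0]
  have hℓe : 1 ≤ ℓ₄ * e := one_le_mul_of_one_le_of_one_le hℓ41 he1
  have i1 : P * Dj ≤ 32 * T₂ * ℓ₄ * e := by
    calc P * Dj ≤ 32 * T₂ := ha'
      _ ≤ 32 * T₂ * (ℓ₄ * e) := le_mul_of_one_le_right (by positivity) hℓe
      _ = _ := by ring
  have i2 : P * (Dj ^ (1 / 3 : ℝ) * (x * y) ^ (2 / 3 : ℝ)) * lg ≤ 8 * T₂ * ℓ₄ * e := by
    calc P * (Dj ^ (1 / 3 : ℝ) * (x * y) ^ (2 / 3 : ℝ)) * lg ≤ 8 * T₂ * ℓ₄ :=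
          mul_le_mul hb' hlg hlg0 (by positivity)
      _ ≤ 8 * T₂ * ℓ₄ * e := le_mul_of_one_le_right (by positivity) he1
  have i3 : (P * (Dj⁻¹ * (x * y) ^ (3 / 2 : ℝ)) + P * (x * y ^ (3 / 4 : ℝ) + y * x ^ (3 / 4 : ℝ))) * e ≤
      5 * T₂ * ℓ₄ * e := by
    refine mul_le_mul_of_nonneg_right ?_ he0
    calc P * (Dj⁻¹ * (x * y) ^ (3 / 2 : ℝ)) + P * (x * y ^ (3 / 4 : ℝ) + y * x ^ (3 / 4 : ℝ))
        ≤ 5 * T₂ := by linarith only [hc', hd']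
      _ ≤ 5 * T₂ * ℓ₄ := le_mul_of_one_le_right (by positivity) hℓ41
  linarith only [i1, i2, i3]

/-- Case C, the trivial part: with `1 ≤ t ≤ P`, `C ≥ 1`, `e ≥ 1`, `e₄ ≤ 4e`, `0 ≤ lg₂ ≤ L`,
`8 (lg₂/P)(d + (x/P + 1) y · C e₄) ≤ 40 C L (T₁ + T₂) e` (terms (e), (f)). [folklore] -/
private theorem caseC_trivial_bound {d x y t P C e e₄ lg₂ L : ℝ} (hd0 : 0 < d) (hx1 : 1 ≤ x) (hy1 : 1 ≤ y)
    (ht : t = d ^ (-(1 / 2 : ℝ)) * (x + y) ^ (-(1 / 8 : ℝ)) * (x * y) ^ (3 / 8 : ℝ)) (ht1 : 1 ≤ t)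
    (hPt : t ≤ P) (hC1 : 1 ≤ C) (he1 : 1 ≤ e) (he₄0 : 0 ≤ e₄) (he₄ : e₄ ≤ 4 * e)
    (hlg0 : 0 ≤ lg₂) (hlg : lg₂ ≤ L) :
    8 * (lg₂ / P) * (d + (x / P + 1) * y * (C * e₄)) ≤
      40 * C * L * ((d * (x + y) ^ (1 / 4 : ℝ) * (x * y) ^ (1 / 4 : ℝ) +
        d ^ (-(1 / 2 : ℝ)) * (x + y) ^ (1 / 8 : ℝ) * (x * y) ^ (9 / 8 : ℝ)) * e) := by
  have hp0 : 0 < x * y := mul_pos (by linarith) (by linarith)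
  have ht0 : 0 < t := by linarith
  have hPr0 : 0 < P := lt_of_lt_of_le ht0 hPt
  have hPr1 : 1 ≤ P := le_trans ht1 hPt
  set T₁ : ℝ := d * (x + y) ^ (1 / 4 : ℝ) * (x * y) ^ (1 / 4 : ℝ) with hT₁
  set T₂ : ℝ := d ^ (-(1 / 2 : ℝ)) * (x + y) ^ (1 / 8 : ℝ) * (x * y) ^ (9 / 8 : ℝ) with hT₂
  have hT₁0 : 0 ≤ T₁ := by positivity
  have hT₂0 : 0 ≤ T₂ := by positivity
  have he0 : 0 ≤ e := le_trans zero_le_one he1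
  have hdP : d / P ≤ T₁ := by
    calc d / P ≤ d / t := div_le_div_of_nonneg_left hd0.le ht0 hPt
      _ ≤ T₁ := by rw [hT₁, ht]; exact term_e hd0 hx1 hy1 (ht ▸ ht1)
  have hpP : x * y / P ^ 2 ≤ T₁ := by
    calc x * y / P ^ 2 ≤ x * y / t ^ 2 :=
          div_le_div_of_nonneg_left hp0.le (by positivity) (pow_le_pow_left₀ ht0.le hPt 2)
      _ = T₁ := by rw [hT₁, ht]; exact term_f1 hd0 hx1 hy1
  have hyP : y / P ≤ T₂ := by
    calc y / P ≤ y := div_le_self (by linarith) hPr1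
      _ ≤ (x + y) ^ (1 / 4 : ℝ) * (x * y) ^ (3 / 4 : ℝ) := (le_quarter_mul hx1 hy1).1
      _ ≤ T₂ := by rw [hT₂]; exact quarter_mul_le_T₂ hx1 hy1 (ht ▸ ht1)
  have e0 : 8 * (lg₂ / P) * (d + (x / P + 1) * y * (C * e₄)) =
      8 * lg₂ * (d / P + (x * y / P ^ 2 + y / P) * (C * e₄)) := by
    field_simp
  rw [e0]
  have hin : d / P + (x * y / P ^ 2 + y / P) * (C * e₄) ≤ 5 * C * ((T₁ + T₂) * e) := by
    have i1 : (x * y / P ^ 2 + y / P) * (C * e₄) ≤ (T₁ + T₂) * (C * (4 * e)) :=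
      mul_le_mul (by linarith only [hpP, hyP]) (mul_le_mul_of_nonneg_left he₄ (by linarith))
        (by positivity) (by positivity)
    have i2 : d / P ≤ C * ((T₁ + T₂) * e) := by
      calc d / P ≤ T₁ := hdP
        _ ≤ T₁ + T₂ := by linarith only [hT₂0]
        _ ≤ (T₁ + T₂) * e := le_mul_of_one_le_right (by positivity) he1
        _ ≤ C * ((T₁ + T₂) * e) := le_mul_of_one_le_left (by positivity) hC1
    have : (T₁ + T₂) * (C * (4 * e)) = 4 * (C * ((T₁ + T₂) * e)) := by ring
    rw [this] at i1
    linarith only [i1, i2]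
  have hCe : 0 ≤ 5 * C * ((T₁ + T₂) * e) := by
    have : 0 ≤ C := by linarith
    positivity
  calc 8 * lg₂ * (d / P + (x * y / P ^ 2 + y / P) * (C * e₄))
      ≤ 8 * L * (5 * C * ((T₁ + T₂) * e)) :=
        mul_le_mul (mul_le_mul_of_nonneg_left hlg (by norm_num)) hin
          (by
            have : 0 ≤ C := by linarith
            positivity) (by linarith)
    _ = 40 * C * L * ((T₁ + T₂) * e) := by ring

/-- Case B, the bracket of (12.4) at level `d`: with `t ≤ P₁`, `1 ≤ P₁`, `0 ≤ lg ≤ K e`, `K ≥ 1`,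
`e ≥ 1`, `e·e = E`:
`d + d^{1/3}(xy)^{2/3} lg + (d⁻¹(xy)^{3/2} + x y^{3/4} + y x^{3/4}) e ≤ 8 P₁⁴ K (T₁ + T₂) E`.
[folklore] -/
private theorem caseB_bracket {d x y P₁ lg K e E : ℝ} (hd1 : 1 ≤ d) (hx1 : 1 ≤ x) (hy1 : 1 ≤ y)
    (hP₁ : 1 ≤ P₁) (hB : d ^ (-(1 / 2 : ℝ)) * (x + y) ^ (-(1 / 8 : ℝ)) * (x * y) ^ (3 / 8 : ℝ) ≤ P₁)
    (hlg0 : 0 ≤ lg) (hlg : lg ≤ K * e) (hK1 : 1 ≤ K) (he1 : 1 ≤ e) (heE : e * e = E) :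
    d + d ^ (1 / 3 : ℝ) * (x * y) ^ (2 / 3 : ℝ) * lg +
        (d⁻¹ * (x * y) ^ (3 / 2 : ℝ) + x * y ^ (3 / 4 : ℝ) + y * x ^ (3 / 4 : ℝ)) * e ≤
      8 * P₁ ^ 4 * K * ((d * (x + y) ^ (1 / 4 : ℝ) * (x * y) ^ (1 / 4 : ℝ) +
        d ^ (-(1 / 2 : ℝ)) * (x + y) ^ (1 / 8 : ℝ) * (x * y) ^ (9 / 8 : ℝ)) * E) := by
  have hd0 : 0 < d := by linarith
  obtain ⟨hb1, hb2, hb3, hb4⟩ := caseB_bound hd1 hx1 hy1 hP₁ hB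
  set T₁ : ℝ := d * (x + y) ^ (1 / 4 : ℝ) * (x * y) ^ (1 / 4 : ℝ) with hT₁
  set T₂ : ℝ := d ^ (-(1 / 2 : ℝ)) * (x + y) ^ (1 / 8 : ℝ) * (x * y) ^ (9 / 8 : ℝ) with hT₂
  have hT₁0 : 0 ≤ T₁ := by positivity
  have hT₂0 : 0 ≤ T₂ := by positivity
  have he0 : 0 ≤ e := le_trans zero_le_one he1
  have hK0 : 0 ≤ K := le_trans zero_le_one hK1
  have hP2 : (1 : ℝ) ≤ P₁ ^ 2 := one_le_pow₀ hP₁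
  have hP4 : P₁ ^ 2 ≤ P₁ ^ 4 := pow_le_pow_right₀ hP₁ (by norm_num)
  have hE : e ≤ E := by
    calc e = e * 1 := (mul_one e).symm
      _ ≤ e * e := mul_le_mul_of_nonneg_left he1 he0
      _ = E := heE
  have hE0 : 0 ≤ E := le_trans he0 hE
  have e1 : d ^ (1 / 3 : ℝ) * (x * y) ^ (2 / 3 : ℝ) * lg ≤ P₁ ^ 2 * T₁ * (K * e) :=
    mul_le_mul hb2 hlg hlg0 (by positivity)
  have e2 : (d⁻¹ * (x * y) ^ (3 / 2 : ℝ) + x * y ^ (3 / 4 : ℝ) + y * x ^ (3 / 4 : ℝ)) * e ≤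
      (6 * P₁ ^ 4 * T₁) * e := by
    refine mul_le_mul_of_nonneg_right ?_ he0
    have := mul_le_mul_of_nonneg_right hP4 hT₁0
    linarith only [hb3, hb4, this]
  have e3 : d ≤ T₁ * (K * e) :=
    hb1.trans (le_mul_of_one_le_right hT₁0 (one_le_mul_of_one_le_of_one_le hK1 he1))
  have hTK : 0 ≤ T₁ * K := mul_nonneg hT₁0 hK0
  calc d + d ^ (1 / 3 : ℝ) * (x * y) ^ (2 / 3 : ℝ) * lg +
      (d⁻¹ * (x * y) ^ (3 / 2 : ℝ) + x * y ^ (3 / 4 : ℝ) + y * x ^ (3 / 4 : ℝ)) * e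
      ≤ T₁ * (K * e) + P₁ ^ 2 * T₁ * (K * e) + (6 * P₁ ^ 4 * T₁) * e := by linarith only [e1, e2, e3]
    _ = (T₁ * K + P₁ ^ 2 * (T₁ * K) + 6 * P₁ ^ 4 * T₁) * e := by ring
    _ ≤ (8 * P₁ ^ 4 * K * T₁) * e := by
        refine mul_le_mul_of_nonneg_right ?_ he0
        have i1 : T₁ * K ≤ P₁ ^ 4 * (T₁ * K) := le_mul_of_one_le_left hTK (hP2.trans hP4)
        have i2 : P₁ ^ 2 * (T₁ * K) ≤ P₁ ^ 4 * (T₁ * K) := mul_le_mul_of_nonneg_right hP4 hTK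
        have i3 : 6 * P₁ ^ 4 * T₁ ≤ 6 * P₁ ^ 4 * (T₁ * K) :=
          mul_le_mul_of_nonneg_left (le_mul_of_one_le_right hT₁0 hK1) (by positivity)
        linarith only [i1, i2, i3]
    _ ≤ (8 * P₁ ^ 4 * K * T₁) * E := mul_le_mul_of_nonneg_left hE (by positivity)
    _ ≤ 8 * P₁ ^ 4 * K * ((T₁ + T₂) * E) := by
        have : T₁ * E ≤ (T₁ + T₂) * E := mul_le_mul_of_nonneg_right (by linarith only [hT₂0]) hE0
        have h8 : (0 : ℝ) ≤ 8 * P₁ ^ 4 * K := by positivity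
        calc 8 * P₁ ^ 4 * K * T₁ * E = 8 * P₁ ^ 4 * K * (T₁ * E) := by ring
          _ ≤ 8 * P₁ ^ 4 * K * ((T₁ + T₂) * E) := mul_le_mul_of_nonneg_left this h8

set_option maxHeartbeats 800000 in
/-- **Proposition 13.1 from Proposition 12.1** [FI, (13.5)]: for every `0 < ε ≤ 1` and every
`C₁₂ ≥ 0` such that the bound (12.3)–(12.4) of Proposition 12.1 holds at ALL levels `D' ≥ 1`
(with `(RS)^{ε/2}`; coefficients supported on `(r, 2s) = 1`), there is `C₁₃ ≥ 0` with
`V(D) ≤ C₁₃ {D(R+S)^{1/4}(RS)^{1/4} + D^{-1/2}(R+S)^{1/8}(RS)^{9/8}}(RS)^ε Σ τ(r)|α_{rs}|²`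
for all `D, R, S ≥ 1` and all `α_{rs}` supported on `(r, 2s) = 1`. Proof as printed: inside (13.6)
by (13.4) at `P = ⌈D^{-1/2}(R+S)^{-1/8}(RS)^{3/8}⌉` with (12.3) at the three levels `2^jDP²`;
below (13.6) by Proposition 11.1 (tree), above it — and for the finitely many `P < P₀` — by (12.3)
at level `D`. [cite: FriedlanderIwaniecAnnals1998, Proposition 13.1] -/
theorem jtV_prop131_of_prop121 {ε : ℝ} (hε : 0 < ε) (hε1 : ε ≤ 1) {C₁₂ : ℝ} (hC₁₂ : 0 ≤ C₁₂)
    (h12 : ∀ (D R S : ℕ) (α : ℕ → ℕ → ℂ), 1 ≤ D → 1 ≤ R → 1 ≤ S →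
      (∀ r s, α r s ≠ 0 → r.Coprime (2 * s)) →
      jtV D (2 * D) R S α ≤ C₁₂ * ((D : ℝ) + (D : ℝ) ^ (1 / 3 : ℝ) * ((R : ℝ) * S) ^ (2 / 3 : ℝ) *
            Real.log (2 * R * S) ^ 4 +
          ((D : ℝ)⁻¹ * ((R : ℝ) * S) ^ (3 / 2 : ℝ) + R * (S : ℝ) ^ (3 / 4 : ℝ) + S * (R : ℝ) ^ (3 / 4 : ℝ)) *
            ((R : ℝ) * S) ^ (ε / 2)) *
        ∑ r ∈ Ioc R (2 * R), ∑ s ∈ Ioc S (2 * S), (σ 0 r : ℝ) * ‖α r s‖ ^ 2) :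
    ∃ C₁₃ : ℝ, 0 ≤ C₁₃ ∧ ∀ (D R S : ℕ) (α : ℕ → ℕ → ℂ), 1 ≤ D → 1 ≤ R → 1 ≤ S →
      (∀ r s, α r s ≠ 0 → r.Coprime (2 * s)) →
      jtV D (2 * D) R S α ≤ C₁₃ * (((D : ℝ) * ((R : ℝ) + S) ^ (1 / 4 : ℝ) * ((R : ℝ) * S) ^ (1 / 4 : ℝ) +
          (D : ℝ) ^ (-(1 / 2 : ℝ)) * ((R : ℝ) + S) ^ (1 / 8 : ℝ) * ((R : ℝ) * S) ^ (9 / 8 : ℝ)) *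
            ((R : ℝ) * S) ^ ε) *
        ∑ r ∈ Ioc R (2 * R), ∑ s ∈ Ioc S (2 * S), (σ 0 r : ℝ) * ‖α r s‖ ^ 2 := by
  have hε2 : 0 < ε / 2 := half_pos hε
  obtain ⟨C₁₁, hC₁₁, h11⟩ := exists_jtV_le hε
  obtain ⟨C, hC1, P₀, hP₀2, hLB⟩ := jtV_le_of_level_bounds' hε2
  -- the log-absorption constant
  set a : ℝ := ε / 12 with ha
  have ha0 : 0 < a := by rw [ha]; positivity
  have ha6 : 6 * a = ε / 2 := by rw [ha]; ring
  have ha61 : 6 * a ≤ 1 := by rw [ha6]; linarith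
  set Kℓ : ℝ := 8 * a⁻¹ ^ 6 with hKℓ
  have hainv : (1 : ℝ) ≤ a⁻¹ := by
    rw [one_le_inv₀ ha0, ha]; linarith
  have hKℓ1 : 1 ≤ Kℓ := by
    rw [hKℓ]
    have : (1 : ℝ) ≤ a⁻¹ ^ 6 := one_le_pow₀ hainv
    linarith
  have hKℓ0 : 0 ≤ Kℓ := le_trans zero_le_one hKℓ1
  have hP₀r : (2 : ℝ) ≤ P₀ := by exact_mod_cast hP₀2
  have hP₀1 : (1 : ℝ) ≤ P₀ := by linarith
  have hP40 : (0 : ℝ) ≤ (P₀ : ℝ) ^ 4 := by positivity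
  have hC0 : 0 ≤ C := le_trans zero_le_one hC1
  set C₁₃ : ℝ := 7 * C₁₁ + 8 * C₁₂ * (P₀ : ℝ) ^ 4 * Kℓ + (6480 * C₁₂ + 40 * C) * Kℓ with hC₁₃
  have hK_A : 7 * C₁₁ ≤ C₁₃ := by
    rw [hC₁₃]; nlinarith [mul_nonneg (mul_nonneg hC₁₂ hP40) hKℓ0, mul_nonneg hC₁₂ hKℓ0, mul_nonneg hC0 hKℓ0]
  have hK_B : 8 * C₁₂ * (P₀ : ℝ) ^ 4 * Kℓ ≤ C₁₃ := by
    rw [hC₁₃]; nlinarith [hC₁₁.le, mul_nonneg hC₁₂ hKℓ0, mul_nonneg hC0 hKℓ0]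
  have hK_C : (6480 * C₁₂ + 40 * C) * Kℓ ≤ C₁₃ := by
    rw [hC₁₃]; nlinarith [hC₁₁.le, mul_nonneg (mul_nonneg hC₁₂ hP40) hKℓ0]
  refine ⟨C₁₃, by positivity, fun D R S α hD hR hS hα2 => ?_⟩
  have hαc : ∀ r s, α r s ≠ 0 → r.Coprime s := fun r s h => (hα2 r s h).coprime_mul_left_right
  -- real shorthands
  set x : ℝ := (R : ℝ) with hx
  set y : ℝ := (S : ℝ) with hy
  set d : ℝ := (D : ℝ) with hd
  have hx1 : 1 ≤ x := by rw [hx]; exact_mod_cast hR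
  have hy1 : 1 ≤ y := by rw [hy]; exact_mod_cast hS
  have hd1 : 1 ≤ d := by rw [hd]; exact_mod_cast hD
  have hd0 : 0 < d := by linarith
  have hs0 : 0 < x + y := by linarith
  have hs1 : (1 : ℝ) ≤ x + y := by linarith
  have hp0 : 0 < x * y := mul_pos (by linarith) (by linarith)
  have hp1 : 1 ≤ x * y := by nlinarith
  set Nτ : ℝ := ∑ r ∈ Ioc R (2 * R), ∑ s ∈ Ioc S (2 * S), (σ 0 r : ℝ) * ‖α r s‖ ^ 2 with hNτ
  have hNτ0 : 0 ≤ Nτ := by rw [hNτ]; positivity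
  have hN2 : ∑ r ∈ Ioc R (2 * R), ∑ s ∈ Ioc S (2 * S), ‖α r s‖ ^ 2 ≤ Nτ := normSq_le_tau_normSq' R S α
  have hN20 : 0 ≤ ∑ r ∈ Ioc R (2 * R), ∑ s ∈ Ioc S (2 * S), ‖α r s‖ ^ 2 := by positivity
  set T₁ : ℝ := d * (x + y) ^ (1 / 4 : ℝ) * (x * y) ^ (1 / 4 : ℝ) with hT₁
  set T₂ : ℝ := d ^ (-(1 / 2 : ℝ)) * (x + y) ^ (1 / 8 : ℝ) * (x * y) ^ (9 / 8 : ℝ) with hT₂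
  have hT₁0 : 0 ≤ T₁ := by positivity
  have hT₂0 : 0 ≤ T₂ := by positivity
  have hpe1 : 1 ≤ (x * y) ^ ε := Real.one_le_rpow hp1 hε.le
  have hpe2 : 1 ≤ (x * y) ^ (ε / 2) := Real.one_le_rpow hp1 hε2.le
  have hpe0 : 0 ≤ (x * y) ^ (ε / 2) := by positivity
  have hpe : (x * y) ^ (ε / 2) * (x * y) ^ (ε / 2) = (x * y) ^ ε := by
    rw [← Real.rpow_add hp0]; ring_nf
  have hX0 : 0 ≤ (T₁ + T₂) * (x * y) ^ ε := by positivity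
  -- the final shape
  have hgoal : ∀ {K : ℝ}, K ≤ C₁₃ → jtV D (2 * D) R S α ≤ K * ((T₁ + T₂) * (x * y) ^ ε) * Nτ →
      jtV D (2 * D) R S α ≤ C₁₃ * ((T₁ + T₂) * (x * y) ^ ε) * Nτ := by
    intro K hKle hV
    exact hV.trans (mul_le_mul_of_nonneg_right (mul_le_mul_of_nonneg_right hKle hX0) hNτ0)
  -- logs
  set ℓ : ℝ := Real.log (8 * (x * y)) with hℓ
  have hℓ1 : 1 ≤ ℓ := by
    rw [hℓ]
    calc (1 : ℝ) ≤ Real.log 8 := half_le_log_two.2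
      _ ≤ Real.log (8 * (x * y)) := Real.log_le_log (by norm_num) (by nlinarith)
  have hℓ0 : 0 ≤ ℓ := by linarith
  have hℓ6 : ℓ ^ 6 ≤ Kℓ * (x * y) ^ (ε / 2) := by
    rw [hℓ, hKℓ, ← ha6]; exact log_pow_six_le hp1 ha0 ha61
  have hℓ2 : Real.log (2 * x * y) ≤ ℓ := by
    rw [hℓ]; exact Real.log_le_log (by positivity) (by nlinarith)
  have hℓ20 : 0 ≤ Real.log (2 * x * y) := Real.log_nonneg (by nlinarith)
  have hℓ41 : (1 : ℝ) ≤ ℓ ^ 4 := one_le_pow₀ hℓ1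
  have hl4 : Real.log (2 * x * y) ^ 4 ≤ ℓ ^ 4 := pow_le_pow_left₀ hℓ20 hℓ2 4
  have hℓ46 : ℓ ^ 4 ≤ ℓ ^ 6 := pow_le_pow_right₀ hℓ1 (by norm_num)
  have hℓ4K : Real.log (2 * x * y) ^ 4 ≤ Kℓ * (x * y) ^ (ε / 2) := hl4.trans (hℓ46.trans hℓ6)
  have hcast : (2 : ℝ) * R * S = 2 * x * y := by rw [hx, hy]
  -- the printed `P`
  set t : ℝ := d ^ (-(1 / 2 : ℝ)) * (x + y) ^ (-(1 / 8 : ℝ)) * (x * y) ^ (3 / 8 : ℝ) with ht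
  have ht0 : 0 < t := by positivity
  by_cases hA : d ≤ (x + y) ^ (1 / 4 : ℝ) * (x * y) ^ (1 / 4 : ℝ)
  · -- Case A: Proposition 11.1
    have hV := h11 D R S α hD hR hS
    have hbd := caseA_bound hd0 hx1 hy1 hA
    have h1 : x * y / Real.sqrt d + (d * Real.sqrt (x * y) + x * y ^ (3 / 4 : ℝ) + y * x ^ (3 / 4 : ℝ)) *
        (x * y) ^ ε ≤ 7 * ((T₁ + T₂) * (x * y) ^ ε) := by
      have h0 : 0 ≤ x * y / Real.sqrt d := by positivity
      have hTe : 0 ≤ T₁ * (x * y) ^ ε := by positivity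
      calc x * y / Real.sqrt d + (d * Real.sqrt (x * y) + x * y ^ (3 / 4 : ℝ) + y * x ^ (3 / 4 : ℝ)) * (x * y) ^ ε
          ≤ x * y / Real.sqrt d * (x * y) ^ ε +
            (d * Real.sqrt (x * y) + x * y ^ (3 / 4 : ℝ) + y * x ^ (3 / 4 : ℝ)) * (x * y) ^ ε := by
            have := le_mul_of_one_le_right h0 hpe1
            linarith only [this]
        _ = (x * y / Real.sqrt d + d * Real.sqrt (x * y) + x * y ^ (3 / 4 : ℝ) + y * x ^ (3 / 4 : ℝ)) *
              (x * y) ^ ε := by ring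
        _ ≤ 7 * T₂ * (x * y) ^ ε := mul_le_mul_of_nonneg_right hbd (by positivity)
        _ = 7 * ((T₁ + T₂) * (x * y) ^ ε) - 7 * (T₁ * (x * y) ^ ε) := by ring
        _ ≤ 7 * ((T₁ + T₂) * (x * y) ^ ε) := by linarith only [hTe]
    refine hgoal hK_A ?_
    calc jtV D (2 * D) R S α ≤ _ := hV
      _ ≤ C₁₁ * (7 * ((T₁ + T₂) * (x * y) ^ ε)) * Nτ :=
          mul_le_mul (mul_le_mul_of_nonneg_left h1 hC₁₁.le) hN2 hN20 (by positivity)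
      _ = 7 * C₁₁ * ((T₁ + T₂) * (x * y) ^ ε) * Nτ := by ring
  · rw [not_le] at hA
    by_cases hB : t < P₀
    · -- Case B: Proposition 12.1 at level `D`
      have hV := h12 D R S α hD hR hS hα2
      rw [hcast] at hV
      have hbr := caseB_bracket hd1 hx1 hy1 hP₀1 hB.le (pow_nonneg hℓ20 4) hℓ4K hKℓ1 hpe2 hpe
      refine hgoal hK_B ?_
      calc jtV D (2 * D) R S α ≤ _ := hV
        _ ≤ C₁₂ * (8 * (P₀ : ℝ) ^ 4 * Kℓ * ((T₁ + T₂) * (x * y) ^ ε)) * Nτ :=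
            mul_le_mul_of_nonneg_right (mul_le_mul_of_nonneg_left hbr hC₁₂) hNτ0
        _ = 8 * C₁₂ * (P₀ : ℝ) ^ 4 * Kℓ * ((T₁ + T₂) * (x * y) ^ ε) * Nτ := by ring
    · -- Case C: the principle of enlarging moduli at `P = ⌈t⌉`
      rw [not_lt] at hB
      have ht1 : 1 ≤ t := le_trans hP₀1 hB
      set P : ℕ := ⌈t⌉₊ with hPdef
      have hPt : t ≤ (P : ℝ) := Nat.le_ceil t
      have hP2t : (P : ℝ) ≤ 2 * t := by
        have := Nat.ceil_lt_add_one ht0.le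
        rw [← hPdef] at this; linarith only [this, ht1]
      have hP₀P : P₀ ≤ P := by
        have : (P₀ : ℝ) ≤ (P : ℝ) := hB.trans hPt
        exact_mod_cast this
      have hPge2 : 2 ≤ P := le_trans hP₀2 hP₀P
      have hP1 : 1 ≤ P := by omega
      have hPr0 : (0 : ℝ) < P := by exact_mod_cast hP1
      have hPr1 : (1 : ℝ) ≤ P := by exact_mod_cast hP1
      -- `d ≤ xy`, `t ≤ xy`, and the logarithms
      have hdup : d ≤ (x + y) ^ (-(1 / 4 : ℝ)) * (x * y) ^ (3 / 4 : ℝ) := le_upper_of_one_le_t hd0 hx1 hy1 ht1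
      have hdp : d ≤ x * y := by
        calc d ≤ (x + y) ^ (-(1 / 4 : ℝ)) * (x * y) ^ (3 / 4 : ℝ) := hdup
          _ ≤ 1 * (x * y) ^ (1 : ℝ) :=
              mul_le_mul (Real.rpow_le_one_of_one_le_of_nonpos hs1 (by norm_num))
                (Real.rpow_le_rpow_of_exponent_le hp1 (by norm_num)) (by positivity) zero_le_one
          _ = x * y := by rw [one_mul, Real.rpow_one]
      have htp : t ≤ x * y := by
        calc t ≤ 1 * 1 * (x * y) ^ (1 : ℝ) := by
              rw [ht]
              exact mul_le_mul (mul_le_mul (Real.rpow_le_one_of_one_le_of_nonpos hd1 (by norm_num))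
                (Real.rpow_le_one_of_one_le_of_nonpos hs1 (by norm_num)) (by positivity) zero_le_one)
                (Real.rpow_le_rpow_of_exponent_le hp1 (by norm_num)) (by positivity) (by positivity)
          _ = x * y := by rw [one_mul, one_mul, Real.rpow_one]
      have hlog2P : Real.log (2 * P) ≤ ℓ := by
        rw [hℓ]; exact Real.log_le_log (by positivity) (by linarith only [hP2t, htp])
      have hlog2P0 : 0 ≤ Real.log (2 * P) := Real.log_nonneg (by linarith only [hPr1])
      have hM : ((1 + Nat.log P (8 * D) / 2 : ℕ) : ℝ) ≤ 3 * ℓ := by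
        have := multiplicity_le hPge2 hD hdp
        linarith only [this, hℓ1]
      have hlev : ∀ j : ℕ, j ≤ 2 → 1 ≤ 2 ^ j * (D * P ^ 2) ∧
          ((2 ^ j * (D * P ^ 2) : ℕ) : ℝ) ≤ 4 * (d * (P : ℝ) ^ 2) ∧ d * (P : ℝ) ^ 2 ≤ ((2 ^ j * (D * P ^ 2) : ℕ) : ℝ) :=
        fun j hj => level_facts hD hP1 hj
      -- the level bounds `L_j` from Proposition 12.1
      set L : ℕ → ℝ := fun j => C₁₂ * ((((2 ^ j * (D * P ^ 2) : ℕ) : ℝ)) +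
          (((2 ^ j * (D * P ^ 2) : ℕ) : ℝ)) ^ (1 / 3 : ℝ) * (x * y) ^ (2 / 3 : ℝ) * Real.log (2 * x * y) ^ 4 +
        ((((2 ^ j * (D * P ^ 2) : ℕ) : ℝ))⁻¹ * (x * y) ^ (3 / 2 : ℝ) + x * y ^ (3 / 4 : ℝ) + y * x ^ (3 / 4 : ℝ)) *
          (x * y) ^ (ε / 2)) with hL
      have hLj : ∀ j : ℕ, j ≤ 2 → jtV (2 ^ j * (D * P ^ 2)) (2 * (2 ^ j * (D * P ^ 2))) R S α ≤ L j * Nτ := by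
        intro j hj
        have h := h12 (2 ^ j * (D * P ^ 2)) R S α (hlev j hj).1 hR hS hα2
        rw [hcast] at h
        exact h
      have hPL : ∀ j : ℕ, j ≤ 2 → (P : ℝ) * L j ≤ C₁₂ * (45 * T₂ * ℓ ^ 4 * (x * y) ^ (ε / 2)) := by
        intro j hj
        obtain ⟨-, hDj4, hDj1⟩ := hlev j hj
        have h := caseC_level_bound hd0 hx1 hy1 ht ht0 hPt hP2t hDj1 hDj4 (pow_nonneg hℓ20 4) hl4 hℓ41 hpe2
        have e : (P : ℝ) * L j = C₁₂ * ((P : ℝ) * ((((2 ^ j * (D * P ^ 2) : ℕ) : ℝ)) +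
            (((2 ^ j * (D * P ^ 2) : ℕ) : ℝ)) ^ (1 / 3 : ℝ) * (x * y) ^ (2 / 3 : ℝ) * Real.log (2 * x * y) ^ 4 +
            ((((2 ^ j * (D * P ^ 2) : ℕ) : ℝ))⁻¹ * (x * y) ^ (3 / 2 : ℝ) + x * y ^ (3 / 4 : ℝ) + y * x ^ (3 / 4 : ℝ)) *
              (x * y) ^ (ε / 2))) := by rw [hL]; ring
        rw [e]
        exact mul_le_mul_of_nonneg_left h hC₁₂
      have h0 := hLj 0 (by norm_num)
      have h1 := hLj 1 (by norm_num)
      have h2 := hLj 2 (by norm_num)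
      have e10 : 2 ^ 0 * (D * P ^ 2) = D * P ^ 2 := by ring
      have e11 : 2 ^ 1 * (D * P ^ 2) = 2 * (D * P ^ 2) := by ring
      have e4 : 2 * (2 * (D * P ^ 2)) = 4 * (D * P ^ 2) := by ring
      have e12 : (2 : ℕ) ^ 2 * (D * P ^ 2) = 4 * (D * P ^ 2) := by norm_num
      have e8 : 2 * (4 * (D * P ^ 2)) = 8 * (D * P ^ 2) := by ring
      rw [e10] at h0
      rw [e11, e4] at h1
      rw [e12, e8] at h2
      have hV := hLB P D R S hP₀P α hαc (L 0) (L 1) (L 2) h0 h1 h2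
      have hPL0 := hPL 0 (by norm_num)
      have hPL1 := hPL 1 (by norm_num)
      have hPL2 := hPL 2 (by norm_num)
      have hsumL : (P : ℝ) * (L 0 + L 1 + L 2) ≤ 135 * C₁₂ * T₂ * ℓ ^ 4 * (x * y) ^ (ε / 2) := by
        have : (P : ℝ) * (L 0 + L 1 + L 2) = (P : ℝ) * L 0 + (P : ℝ) * L 1 + (P : ℝ) * L 2 := by ring
        rw [this]
        linarith only [hPL0, hPL1, hPL2]
      have hfirst : 16 * ((1 + Nat.log P (8 * D) / 2 : ℕ) : ℝ) * P * Real.log (2 * P) * (L 0 + L 1 + L 2) ≤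
          6480 * C₁₂ * Kℓ * ((T₁ + T₂) * (x * y) ^ ε) := by
        have l0 : 0 ≤ L 0 := by simp only [hL]; positivity
        have l1 : 0 ≤ L 1 := by simp only [hL]; positivity
        have l2 : 0 ≤ L 2 := by simp only [hL]; positivity
        have hsum0 : 0 ≤ (P : ℝ) * (L 0 + L 1 + L 2) := by positivity
        have hTe : T₂ * (x * y) ^ ε ≤ (T₁ + T₂) * (x * y) ^ ε :=
          mul_le_mul_of_nonneg_right (by linarith only [hT₁0]) (by positivity)
        calc 16 * ((1 + Nat.log P (8 * D) / 2 : ℕ) : ℝ) * P * Real.log (2 * P) * (L 0 + L 1 + L 2)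
            = 16 * (((1 + Nat.log P (8 * D) / 2 : ℕ) : ℝ) * Real.log (2 * P)) * ((P : ℝ) * (L 0 + L 1 + L 2)) := by
              ring
          _ ≤ 16 * (3 * ℓ * ℓ) * (135 * C₁₂ * T₂ * ℓ ^ 4 * (x * y) ^ (ε / 2)) := by
              refine mul_le_mul (mul_le_mul_of_nonneg_left (mul_le_mul hM hlog2P hlog2P0 (by positivity))
                (by norm_num)) hsumL hsum0 (by positivity)
          _ = 6480 * C₁₂ * T₂ * (ℓ ^ 6 * (x * y) ^ (ε / 2)) := by ring
          _ ≤ 6480 * C₁₂ * T₂ * (Kℓ * (x * y) ^ (ε / 2) * (x * y) ^ (ε / 2)) :=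
              mul_le_mul_of_nonneg_left (mul_le_mul_of_nonneg_right hℓ6 hpe0) (by positivity)
          _ = 6480 * C₁₂ * Kℓ * (T₂ * (x * y) ^ ε) := by rw [mul_assoc Kℓ, hpe]; ring
          _ ≤ 6480 * C₁₂ * Kℓ * ((T₁ + T₂) * (x * y) ^ ε) := mul_le_mul_of_nonneg_left hTe (by positivity)
      have hsecond : 8 * (Real.log (2 * P) / P) *
          (D + ((R : ℝ) / P + 1) * S * (C * ((4 : ℝ) * R * S) ^ (ε / 2))) ≤
          40 * C * Kℓ * ((T₁ + T₂) * (x * y) ^ ε) := by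
        rw [← hx, ← hy, ← hd]
        have h4p : ((4 : ℝ) * x * y) ^ (ε / 2) ≤ 4 * (x * y) ^ (ε / 2) := by
          rw [show (4 : ℝ) * x * y = 4 * (x * y) by ring, Real.mul_rpow (by norm_num) hp0.le]
          refine mul_le_mul_of_nonneg_right ?_ hpe0
          calc (4 : ℝ) ^ (ε / 2) ≤ (4 : ℝ) ^ (1 : ℝ) := Real.rpow_le_rpow_of_exponent_le (by norm_num) (by linarith)
            _ = 4 := Real.rpow_one 4
        have hℓK : Real.log (2 * P) ≤ Kℓ * (x * y) ^ (ε / 2) := by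
          calc Real.log (2 * P) ≤ ℓ := hlog2P
            _ = ℓ ^ 1 := (pow_one ℓ).symm
            _ ≤ ℓ ^ 6 := pow_le_pow_right₀ hℓ1 (by norm_num)
            _ ≤ Kℓ * (x * y) ^ (ε / 2) := hℓ6
        have h := caseC_trivial_bound (C := C) hd0 hx1 hy1 ht ht1 hPt hC1 hpe2 (by positivity) h4p hlog2P0 hℓK
        calc 8 * (Real.log (2 * P) / P) * (d + (x / P + 1) * y * (C * ((4 : ℝ) * x * y) ^ (ε / 2)))
            ≤ 40 * C * (Kℓ * (x * y) ^ (ε / 2)) * ((T₁ + T₂) * (x * y) ^ (ε / 2)) := h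
          _ = 40 * C * Kℓ * ((T₁ + T₂) * ((x * y) ^ (ε / 2) * (x * y) ^ (ε / 2))) := by ring
          _ = 40 * C * Kℓ * ((T₁ + T₂) * (x * y) ^ ε) := by rw [hpe]
      refine hgoal hK_C ?_
      calc jtV D (2 * D) R S α ≤ _ := hV
        _ ≤ (6480 * C₁₂ * Kℓ * ((T₁ + T₂) * (x * y) ^ ε) + 40 * C * Kℓ * ((T₁ + T₂) * (x * y) ^ ε)) * Nτ :=
            mul_le_mul_of_nonneg_right (add_le_add hfirst hsecond) hNτ0
        _ = (6480 * C₁₂ + 40 * C) * Kℓ * ((T₁ + T₂) * (x * y) ^ ε) * Nτ := by ring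

end Literature.NumberTheory.Sieve.FriedlanderIwaniecPrimes
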